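import Literature.MathematicalPhysics.QuantumFieldTheory.Balaban1983to89.B13Bound226BoxTail
import Literature.MathematicalPhysics.QuantumFieldTheory.Balaban1983to89.B13Term214WindowDilatedUnscaled
import Literature.MathematicalPhysics.QuantumFieldTheory.Balaban1983to89.B13ChainJointNonvacuity

/-!
# `Balaban1983to89.B13Bound226Witness` — T. Bałaban, *Renormalization group approach to lattice gauge field theories. II.
Cluster expansions*, Commun. Math. Phys. **116** (1988) 1–22 [Balaban1988RG2Cluster], pp. 15–17, with [Balaban1987RG1]
(2.10)–(2.13) pp. 266–268: **A JOINT SATISFIABILITY WITNESS (A2 ∕ STANDING A6 RULE) FOR THE FULL BINDER LIST OF THE (2.26)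
CAPSTONE FAMILY ALONG THE WINDOW-DILATED FAMILY** — the ≈ 75 hypotheses of
`B13Term214WindowDilated.h226_torus_windowDilated_of_primitives` (members), of
`B13Bound226BoxTail.h226_torus_windowDilated_boxTail_of_primitives` (box tail, `P = ∅`, WITH the box law) and of
`B13Bound226BoxTail.h226_torus_windowDilated_largeField_of_primitives` (large-field members, `P ≠ ∅`, WITH (2.22) and the
surplus radius) are met SIMULTANEOUSLY at ONE explicit one-bond model, for EVERY two-scale torus, EVERY site torus, EVERY
block `Z`, EVERY term label and EVERY constants record of the N10 chain — certified by the kernel by APPLYING the three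
engines with every binder discharged

statement-level skeleton of published theorems with citation tags; proofs where landed; nothing here is a claim about the
Yang–Mills mass gap

CITATION HEADER.  [II] p. 16 (2.22), p. 17 (2.24)–(2.26) and [I] pp. 266–268 (2.10)–(2.13) as quoted in `B13Bound226BoxTail`,
`B13Term214WindowDilated`, `B13Integral223`, `B13Bound226Primitive`; p. 21 [PDF 21]: *"The assumptions allow finally us to fix
all the constants, or rather bounds on these constants."*  NOT PRINTED: any of the model data below — they are WITNESS DATA for
the typed hypothesis lists, not Bałaban's objects.

WHY THIS FILE (cell `pub-ymgap`, HUMAN RULING D-0062 Track A, node N10 = [B13], seat `pub-ymgap-dag-n10-c` g10).  (i) The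
director's STANDING A6 RULE (bus `run/shared/lean/pub/pub-ymgap/INBOX.md` l.20645, №189 (3)): a junction ∕ knit lemma with
member-local binders ships a satisfiability witness or is graded «A6-UNCHECKED»; (ii) the N22 finding of record (№193, l.21633;
referee card `pub-ymgap-dag-ref-G/READS/n22c-p539663.md`): a located-input record one storey ABOVE this seat's engines bundled
the small-field BOX LAW with (2.22) at labels with `P ≠ ∅` and was contradictory there; (iii) the hole named in
`B13ChainJointNonvacuity`'s header: its 69 conjuncts certify the chain's NUMERICAL hypotheses «through (2.19)» but *"nothing
about the object-dependent smallness of the (2.26) capstone (`hαc`, `hsmall`, `hvol`: kernel data θ, K₀, c, g)"*.  This file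
answers all three AT THE ENGINE LEVEL: the capstone family's binder lists — kernels and their (L17a)∕(L16a) letters, the
regions, (2.22), (2.20), the window radius `ρ_b` and the primed letters, `θ`, AND the object-dependent numerics `hθR1le`,
`hsmallKθ`, `hαc`, `hsmall`, `hPa`, `hvol` — are jointly consistent, at both label kinds, with the box law present exactly where
print uses it (`P = ∅`) and (2.22) with `|P| ≥ 1` present exactly where print uses it (`P ≠ ∅`); and the three `c`-hypotheses
are met by the chain's own record (`exists_consts_model`, from `chain_joint_nonvacuous`: print's `q = 8`, R12).

THE MODEL (§1–§4; every piece a transparent `def`, labelled MODEL).  One bond, no constraint-surface variables: `Λ = Fin 1`,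
`C₀ = Fin 0`, both at the base site `x₀` of the site torus `UT Nf` (`m = 1`).  σ-polydisc `univ`; τ-discs `ball 0 R_τ(Y)`,
`R_τ(Y) := |τ(Y)| + e^{κ₁} + 1` (contains the (2.18) contour disc and every Cauchy circle of radius `e^{κ₁} − 1` centred on
`[0,1]`); Cauchy radius `r = e^{κ₁} − 1`.  Kernels: `A(σ) = 1 = C` (`θ_E = θ_C = 0`, `K_{Cσ} = K₀ = K_E = 1`, `c_E = 1` by
`eigenvalues_one_le`), `G(σ) = Γ₀ ≡ ½` (`θ_Γ = 0`, `K_G = K_Γ = ½`, `g = ¼`, `Gam0_form`), `Γ(σ)X = G·X`.  Last line: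
`χ_{Y₀} = 𝟙{⟨B,B⟩ < r_P²|P| + 1}`, `χᶜ_P = 𝟙{r_P²|P| ≤ ⟨B,B⟩}`, `q_P = ⟨B,B⟩`, `γ₂ = 1∕16` — (2.22) at every label
(`h222_model`), the BOX LAW at `|P| = 0` on `⟨B,B⟩ < 1` (`boxLaw_model`), the product `= 1` on a non-empty shell at EVERY label
(`exists_chi_mul_eq_one`); potentials on `𝐃 = t.1`: `W(Y,B) = η⟨B,B⟩` (`η = 1∕(64(S+1)) > 0`, `S = Σ_{Y∈𝐃}R_τ(Y)`), `O(Y,B) = 1`: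
(2.20) with `a₂₀ = 2ηS ≤ 1∕32`, `w = S` (`h220_model`, `etaW_pos_and_rate`).  Numbers (§3): rates `3, 2, 1` (fibre factors
`≤ 3^ν`), `ρ_b = 1∕(128·(3^ν)⁴) > 0` (`one_mem_ball_rhoB`), `θ = 1∕(16·(3^ν)²)`, primed letters `K_G′ = 1, K_{Cσ}′ = 4,
θ_Γ′ = ρ_b∕2, θ_C′ = 10ρ_b, θ_E′ = 3ρ_b, a′ = 1∕16, w′ = 4S`; `hθR1le` (29∕512 ≤ 32∕512), `hsmallKθ` (`≤ 1∕16`), `hαc`∕`hsmall`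
(`≤ ¼·3∕2`), `hvol` with `a₅ = 1 + w` (`vol_model`, uses `|Z| ≥ 1`).

WHAT IS HERE.
* §1 `chiS`, `chiL`, `Wq`, `Oc` + their letters (`h222_model`, `boxLaw_model`, `chi_mul_eq_one_of_shell`, `exists_chi_mul_eq_one`,
  `h220_model`, measurability); §2 `x0`, `Gam0`, `Gm`, `Γm` + `Gam0_form`, `eigenvalues_one_le`, `norm_Gm`, `exp_tdist1_x0`,
  fibre bounds; §3 `rhoB`, `thetaW` + the ν-uniform numerics (`transports_model`, `rhoB_le_thetaW`, `fibreFactors_model`,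
  `hθR1le_model`, `hsmallKθ_model`, `two_theta_F_le`); §4 `Rτ`, `SR`, `etaW` + `Rτ_pos`, `SR_nonneg`, `etaW_pos_and_rate`;
  §5 shared discharges in the engines' binder shapes (`letters_model`, `regions_model`, `vol_model`).
* §6 THE WITNESSES: ★ `h226_windowDilated_model` (module 41 §4 applied at the model: EVERY binder discharged; conclusion on
  the non-empty ball), ★ `boxTail_windowDilated_model` (43B §2 at a `|P| = 0` label, box law + `χχᶜ ≤ 1` + centre potentials),
  ★ `largeField_windowDilated_model` (43B §4 at a `1 ≤ |P|` label, (2.22) + `r₁² ≤ r_P²` + `hPa` at `r₁`).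
* §7 non-emptiness of the binder domains (`one_mem_ball_rhoB`, `Γm_ne_zero`; with `exists_chi_mul_eq_one`, `etaW_pos_and_rate`),
  `exists_consts_model` (the chain's record meets `κ₁ ≥ 1`, `α₆ ≠ 0`, the (2.18) law; `q = 8`, R12), `exists_consts_h226_…`.
* §8 (v1.1, append-only; doc-only page-tag corrections [I] (2.10)–(2.13) ∈ pp. 267–268 per the B13 page ledger of
  `lit-balaban-r10`) THE LOCAL-GROWTH EDITIONS AT THE MODEL — the engines node N22's knits key on: `Wc` (cubic Wilson part
  `κ₃A₀³`, (ℓ1) `Wc_local`), `Oa` (affine older part `1 + κ₁A₀`, (L0)∕(L4) `Oa_letters`), `rhoClip` (clipping radius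
  `s√(r_P²|P|+1)` with the box-SUPPORT law `boxSupport_model`), `kap1`, `kap3` (per-bond multiplicity `perBond_model`, rates
  `rates_localGrowth_model`), ★ `h226_localGrowth_model` (`B13Term214WindowDilatedUnscaled` §2 applied at the model, every
  coupling `s > 0`), ★ `largeField_localGrowth_model` (§5 there, `|P| ≥ 1`, box-SUPPORT law and (2.22) together).
HONEST SCOPE.  A CONSISTENCY certificate for typed hypothesis lists, nothing more: the model kernels are σ-CONSTANT (so off
`Z′₀` the model term is the zero term by `B13SigmaFreeKernels.term214_sigmaFree` — the conclusions' values are not the point;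
that every `∀`-binder ranges over a non-empty domain and all binders hold at once is); one bond, no `C₀`-variables; nothing of
Bałaban's kernels, characteristic functions or potentials is constructed or asserted; the centred engines
(`B13Bound226CentredUnscaled` ∕ `…CentredRem`, parity + exponential-moment letters) are not instantiated here; count-neutral;
N10 ∕ N22 NOT discharged; nothing continuum ∕ OS ∕ mass-gap ∕ Clay.  No `sorry`; transparent model `def`s only (no structure,
no instance, no new named fact, D-0026).
-/

noncomputable section

namespace Literature.MathematicalPhysics.QuantumFieldTheory.Balaban1983to89.B13Bound226Witness

open Matrix MeasureTheory Finset Complex Metric Set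
open scoped Real
open B13Term214 (core214 F214 term214)
open B13Term214WindowDilated (h226_torus_windowDilated_of_primitives)
open B13Bound226BoxTail (h226_torus_windowDilated_boxTail_of_primitives h226_torus_windowDilated_largeField_of_primitives)
open B13Term214WindowDilatedUnscaled (h226_torus_windowDilated_of_localGrowth_perBond
  h226_torus_windowDilated_largeField_of_localGrowth_perBond)
open TreeLengthTorus (TPt TDom tsys)
open TreeLengthTorusTransfer (tclosure)
open B13Lemma3TorusData (TBond)
open B13Lemma3TorusTerms (weight Z0)
open B13Bound143 (invTau)
open B5TorusCover (UT)
open B9Thm37GlueTorus (tdist1 tdist1_self)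

/-! ## §1. The model last line: characteristic functions, potentials, and their letters -/

section LastLine

variable {Λ : Type} [Fintype Λ]

/-- MODEL (witness data). The small-field characteristic function of the model: the indicator of `⟨B,B⟩ < s`.
[cite: Balaban1987RG1, (2.10)-(2.12) pp.267-268] -/
def chiS (s : ℝ) (B : Λ → ℝ) : ℝ := if B ⬝ᵥ B < s then 1 else 0

/-- MODEL (witness data). The large-field characteristic function of the model: the indicator of `s ≤ ⟨B,B⟩`.
[cite: Balaban1987RG1, (2.10)-(2.12) pp.267-268] -/
def chiL (s : ℝ) (B : Λ → ℝ) : ℝ := if s ≤ B ⬝ᵥ B then 1 else 0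

/-- `0 ≤ χ_S`. [cite: Balaban1987RG1, (2.10)-(2.12) pp.267-268] -/
theorem chiS_nonneg (s : ℝ) (B : Λ → ℝ) : 0 ≤ chiS s B := by
  unfold chiS; split_ifs <;> norm_num

/-- `0 ≤ χ_L`. [cite: Balaban1987RG1, (2.10)-(2.12) pp.267-268] -/
theorem chiL_nonneg (s : ℝ) (B : Λ → ℝ) : 0 ≤ chiL s B := by
  unfold chiL; split_ifs <;> norm_num

/-- `χ_S ≤ 1`. [cite: Balaban1987RG1, (2.10)-(2.12) pp.267-268] -/
theorem chiS_le_one (s : ℝ) (B : Λ → ℝ) : chiS s B ≤ 1 := by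
  unfold chiS; split_ifs <;> norm_num

/-- `χ_L ≤ 1`. [cite: Balaban1987RG1, (2.10)-(2.12) pp.267-268] -/
theorem chiL_le_one (s : ℝ) (B : Λ → ℝ) : chiL s B ≤ 1 := by
  unfold chiL; split_ifs <;> norm_num

/-- `χ_S·χ_L ≤ 1`. [cite: Balaban1987RG1, (2.10)-(2.12) pp.267-268] -/
theorem chiS_mul_chiL_le_one (s s' : ℝ) (B : Λ → ℝ) : chiS s B * chiL s' B ≤ 1 :=
  mul_le_one₀ (chiS_le_one s B) (chiL_nonneg s' B) (chiL_le_one s' B)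

/-- The field square `B ↦ ⟨B,B⟩` is measurable. [folklore] -/
private theorem measurable_dotProduct_self : Measurable fun B : Λ → ℝ => B ⬝ᵥ B := by
  unfold dotProduct
  exact Finset.measurable_sum _ fun i _ => (measurable_pi_apply i).mul (measurable_pi_apply i)

/-- `χ_S` is measurable. [cite: Balaban1987RG1, (2.10)-(2.12) pp.267-268] -/
theorem measurable_chiS (s : ℝ) : Measurable (chiS (Λ := Λ) s) := by
  unfold chiS
  exact Measurable.ite (measurableSet_lt measurable_dotProduct_self measurable_const) measurable_const
    measurable_const

/-- `χ_L` is measurable. [cite: Balaban1987RG1, (2.10)-(2.12) pp.267-268] -/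
theorem measurable_chiL (s : ℝ) : Measurable (chiL (Λ := Λ) s) := by
  unfold chiL
  exact Measurable.ite (measurableSet_le measurable_const measurable_dotProduct_self) measurable_const
    measurable_const

/-- **THE MODEL OBEYS (2.22)**: with `χ_{Y₀} := 𝟙{⟨B,B⟩ < s}` (any `s`), `χᶜ_P := 𝟙{r_P²·n ≤ ⟨B,B⟩}` and `q_P := ⟨B,B⟩`,
`χ_{Y₀}χᶜ_P ≤ exp(−½γ₂r_P²n + ½γ₂q_P(B))` for every `γ₂ ≥ 0` — on the support of `χᶜ_P` the exponent is non-negative.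
[cite: Balaban1988RG2Cluster, (2.22) p.16] -/
theorem h222_model (s : ℝ) {γ₂ : ℝ} (hγ₂ : 0 ≤ γ₂) (rP : ℝ) (n : ℕ) (B : Λ → ℝ) :
    chiS s B * chiL (rP ^ 2 * n) B ≤ Real.exp (-(γ₂ / 2 * rP ^ 2 * (n : ℕ)) + γ₂ / 2 * (B ⬝ᵥ B)) := by
  by_cases h : rP ^ 2 * n ≤ B ⬝ᵥ B
  · refine (chiS_mul_chiL_le_one s _ B).trans (Real.one_le_exp ?_)
    have : γ₂ / 2 * (rP ^ 2 * n) ≤ γ₂ / 2 * (B ⬝ᵥ B) := mul_le_mul_of_nonneg_left h (by positivity)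
    linarith
  · have h0 : chiL (rP ^ 2 * n) B = 0 := by unfold chiL; rw [if_neg h]
    rw [h0, mul_zero]
    exact (Real.exp_pos _).le

/-- **THE MODEL OBEYS THE BOX LAW** at a label without large-field boxes (`n = 0`): `χ_{Y₀}χᶜ_P = 1` on `⟨B,B⟩ < s`.
[cite: Balaban1987RG1, (2.10)-(2.12) pp.267-268] -/
theorem boxLaw_model (s rP : ℝ) (B : Λ → ℝ) (hB : B ⬝ᵥ B < s) : chiS s B * chiL (rP ^ 2 * (0 : ℕ)) B = 1 := by
  have h0 : 0 ≤ B ⬝ᵥ B := Finset.sum_nonneg fun i _ => mul_self_nonneg (B i)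
  unfold chiS chiL
  rw [if_pos hB, if_pos (by simpa using h0), one_mul]

/-- **NON-DEGENERACY OF THE MODEL's CHARACTERISTIC FUNCTIONS**: on the shell `r_P²n ≤ ⟨B,B⟩ < r_P²n + s₀` the product
`χ_{Y₀}χᶜ_P` equals `1` (both label kinds: for `n = 0` this is the small-field box, for `n ≥ 1` the large-field shell).
[cite: Balaban1987RG1, (2.10)-(2.12) pp.267-268] -/
theorem chi_mul_eq_one_of_shell (s₀ rP : ℝ) (n : ℕ) (B : Λ → ℝ) (h₁ : rP ^ 2 * n ≤ B ⬝ᵥ B)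
    (h₂ : B ⬝ᵥ B < rP ^ 2 * n + s₀) : chiS (rP ^ 2 * n + s₀) B * chiL (rP ^ 2 * n) B = 1 := by
  unfold chiS chiL
  rw [if_pos h₂, if_pos h₁, one_mul]

/-- The shell is inhabited when the bond set is non-empty and `s₀ > 0`: the constant field `B ≡ √(r_P²n∕|Λ|)` lies on it.
[cite: Balaban1987RG1, (2.10)-(2.12) pp.267-268] -/
theorem exists_chi_mul_eq_one [Nonempty Λ] {s₀ : ℝ} (hs₀ : 0 < s₀) (rP : ℝ) (n : ℕ) :
    ∃ B : Λ → ℝ, chiS (rP ^ 2 * n + s₀) B * chiL (rP ^ 2 * n) B = 1 := by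
  have hcard : 0 < (Fintype.card Λ : ℝ) := Nat.cast_pos.mpr Fintype.card_pos
  have hx : 0 ≤ rP ^ 2 * n / Fintype.card Λ := by positivity
  refine ⟨fun _ => Real.sqrt (rP ^ 2 * n / Fintype.card Λ), chi_mul_eq_one_of_shell s₀ rP n _ ?_ ?_⟩ <;>
  · simp only [dotProduct, Finset.sum_const, Finset.card_univ, nsmul_eq_mul, ← pow_two,
      Real.sq_sqrt hx, mul_div_cancel₀ _ hcard.ne']
    first | exact le_rfl | linarith

/-- MODEL (witness data). The Wilson part of the model potential of a domain: `W(Y,B) := η·⟨B,B⟩` (quadratic in the field).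
[cite: Balaban1988RG2Cluster, (2.20) p.16] -/
def Wq {D : Type*} (η : ℝ) (_Y : D) (B : Λ → ℝ) : ℂ := ((η * (B ⬝ᵥ B) : ℝ) : ℂ)

/-- MODEL (witness data). The older part of the model potential of a domain: the field-constant `O(Y,B) := η`.
[cite: Balaban1988RG2Cluster, (2.20) p.16] -/
def Oc {D : Type*} (η : ℝ) (_Y : D) (_B : Λ → ℝ) : ℂ := (η : ℂ)

/-- `W` is measurable in the field. [cite: Balaban1988RG2Cluster, (2.20) p.16] -/
theorem measurable_Wq {D : Type*} (η : ℝ) (Y : D) : Measurable (Wq (Λ := Λ) η Y) := by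
  unfold Wq
  exact Complex.measurable_ofReal.comp (measurable_dotProduct_self.const_mul η)

omit [Fintype Λ] in
/-- `O` is measurable in the field. [cite: Balaban1988RG2Cluster, (2.20) p.16] -/
theorem measurable_Oc {D : Type*} (η : ℝ) (Y : D) : Measurable (Oc (Λ := Λ) η Y) := measurable_const

/-- **THE MODEL OBEYS THE JOINT (2.20) LETTER** on per-domain τ-discs of radii `R(Y) ≥ 0`: for `η, η′ ≥ 0`,
`Σ_{Y∈D} |τ(Y)|(|W(Y,B)| + |O(Y,B)|) ≤ ½(2ηΣR)⟨B,B⟩ + η′ΣR`. [cite: Balaban1988RG2Cluster, (2.20) p.16] -/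
theorem h220_model {D : Type*} (Dfam : Finset D) {R : D → ℝ} {η η' : ℝ} (hη : 0 ≤ η) (hη' : 0 ≤ η')
    (τ : D → ℂ) (hτ : ∀ Y ∈ Dfam, ‖τ Y‖ ≤ R Y) (B : Λ → ℝ) :
    ∑ Y ∈ Dfam, ‖τ Y‖ * (‖Wq η Y B‖ + ‖Oc η' Y B‖)
      ≤ (2 * (η * ∑ Y ∈ Dfam, R Y)) / 2 * (B ⬝ᵥ B) + η' * ∑ Y ∈ Dfam, R Y := by
  have hB : 0 ≤ B ⬝ᵥ B := Finset.sum_nonneg fun i _ => mul_self_nonneg (B i)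
  have hW : ∀ Y : D, ‖Wq (Λ := Λ) η Y B‖ = η * (B ⬝ᵥ B) := fun Y => by
    unfold Wq; rw [Complex.norm_real, Real.norm_of_nonneg (mul_nonneg hη hB)]
  have hO : ∀ Y : D, ‖Oc (Λ := Λ) η' Y B‖ = η' := fun Y => by
    unfold Oc; rw [Complex.norm_real, Real.norm_of_nonneg hη']
  calc ∑ Y ∈ Dfam, ‖τ Y‖ * (‖Wq η Y B‖ + ‖Oc η' Y B‖)
      ≤ ∑ Y ∈ Dfam, R Y * (η * (B ⬝ᵥ B) + η') := Finset.sum_le_sum fun Y hY => by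
        rw [hW, hO]
        exact mul_le_mul_of_nonneg_right (hτ Y hY) (by positivity)
    _ = (2 * (η * ∑ Y ∈ Dfam, R Y)) / 2 * (B ⬝ᵥ B) + η' * ∑ Y ∈ Dfam, R Y := by
        have h1 : ∑ Y ∈ Dfam, R Y * (η * (B ⬝ᵥ B) + η') = (∑ Y ∈ Dfam, R Y) * (η * (B ⬝ᵥ B) + η') :=
          (Finset.sum_mul _ _ _).symm
        rw [h1]; ring

end LastLine

/-! ## §2. The model block: one bond, reference `C = 1`, precision `A(σ) = 1`, cross operator `Γ₀ ≡ ½`, on the site torus -/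

section Block

variable {ν : ℕ} (Nf : Fin ν → ℕ) [∀ i, NeZero (Nf i)]

/-- MODEL (witness data). The base site of the unit torus where the model bond sits. [cite: Balaban1988RG2Cluster, (2.16) p.16] -/
def x0 : UT Nf := UT.ofSite Nf fun i => (0 : Fin (Nf i))

/-- MODEL (witness data). The real reference cross operator `Γ₀ ≡ ½` of the model (one bond, no `C₀`-variables).
[cite: Balaban1988RG2Cluster, (2.16) p.16] -/
def Gam0 : Matrix (Fin 1) (Fin 1 ⊕ Fin 0) ℝ := Matrix.of fun _ _ => 1 / 2

/-- MODEL (witness data). The (σ-constant) complex cross kernel `G(σ) := Γ₀` of the model.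
[cite: Balaban1988RG2Cluster, (2.16) p.16] -/
def Gm : Matrix (Fin 1) (Fin 1 ⊕ Fin 0) ℂ := Gam0.map (algebraMap ℝ ℂ)

/-- MODEL (witness data). The cross operator `Γ(σ)X := G(σ)·X` of the model. [cite: Balaban1988RG2Cluster, (2.14) p.15] -/
def Γm (X : Fin 1 ⊕ Fin 0 → ℝ) : Fin 1 → ℂ := Gm *ᵥ fun j => (X j : ℂ)

/-- `Γ₀·X = ½X₀`. [cite: Balaban1988RG2Cluster, (2.16) p.16] -/
theorem Gam0_mulVec (X : Fin 1 ⊕ Fin 0 → ℝ) : Gam0 *ᵥ X = fun _ => 1 / 2 * X (Sum.inl 0) := by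
  funext i
  simp [Gam0, Matrix.mulVec, dotProduct, Fintype.sum_sum_type]

/-- The form bound of the model's reference cross operator: `⟨Γ₀X, C Γ₀X⟩ = ¼X₀² ≤ ¼⟨X,X⟩` (`C = 1`).
[cite: Balaban1988RG2Cluster, (2.24) p.17] -/
theorem Gam0_form (X : Fin 1 ⊕ Fin 0 → ℝ) :
    (Gam0 *ᵥ X) ⬝ᵥ ((1 : Matrix (Fin 1) (Fin 1) ℝ) *ᵥ (Gam0 *ᵥ X)) ≤ 1 / 4 * (X ⬝ᵥ X) := by
  rw [Matrix.one_mulVec, Gam0_mulVec]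
  simp only [dotProduct, Fin.sum_univ_one, Fintype.sum_sum_type, Finset.univ_eq_empty, Finset.sum_empty, add_zero]
  nlinarith [mul_self_nonneg (X (Sum.inl 0))]

/-- The eigenvalues of the model reference `C = 1` (one bond) are `≤ 1`. [cite: Balaban1988RG2Cluster, (2.24) p.17] -/
theorem eigenvalues_one_le (hC : (1 : Matrix (Fin 1) (Fin 1) ℝ).PosDef) (k : Fin 1) : hC.1.eigenvalues k ≤ 1 := by
  have h := hC.1.det_eq_prod_eigenvalues
  rw [Matrix.det_one, Fin.prod_univ_one] at h
  have hk : k = 0 := Subsingleton.elim _ _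
  subst hk
  have : hC.1.eigenvalues 0 = 1 := by simpa using h.symm
  rw [this]

/-- The kernel letters of the model's cross operator: `|G(σ)_{bj}| = |Γ₀_{bj}| = ½`. [cite: Balaban1988RG2Cluster, (2.16) p.16] -/
theorem norm_Gm (b : Fin 1) (j : Fin 1 ⊕ Fin 0) : ‖Gm b j‖ = 1 / 2 ∧ ‖Gam0 b j‖ = 1 / 2 := by
  constructor
  · simp [Gm, Gam0, Matrix.map_apply]
  · simp [Gam0]

/-- The model's located kernel letter: at the base site the (L17a)-weight is `1` (`d₁(x₀,x₀) = 0`).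
[cite: Balaban1988RG2Cluster, (2.16) p.16] -/
theorem exp_tdist1_x0 (kap : ℝ) : Real.exp (-(kap * tdist1 Nf (x0 Nf) (x0 Nf))) = 1 := by
  rw [tdist1_self, mul_zero, neg_zero, Real.exp_zero]

/-- One bond per site: the fibres of the constant location map `Λ = Fin 1 → {x₀}` have `≤ 1` element.
[cite: Balaban1988RG2Cluster, (2.16) p.16] -/
theorem fib_model_Λ (x : UT Nf) : (Finset.univ.filter fun _ : Fin 1 => x0 Nf = x).card ≤ 1 :=
  (Finset.card_filter_le _ _).trans (by simp)

/-- One row index per site: the fibres of the constant location map on `Λ ⊕ C₀ = Fin 1 ⊕ Fin 0` have `≤ 1` element.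
[cite: Balaban1988RG2Cluster, (2.16) p.16] -/
theorem fib_model_N (x : UT Nf) : (Finset.univ.filter fun _ : Fin 1 ⊕ Fin 0 => x0 Nf = x).card ≤ 1 :=
  (Finset.card_filter_le _ _).trans (by simp [Fintype.card_sum])

end Block

/-! ## §3. The model numbers: radius of the `b`-ball, the letter `θ`, and the capstone's numeric conditions for every `ν` -/

section Numbers

/-- MODEL (witness data). The radius of the `b`-ball of the model, `ρ_b := 1∕(128·(3^ν)⁴)` (`ν` = site-torus dimension).
[cite: Balaban1988RG2Cluster, (2.24) p.17] -/
def rhoB (ν : ℕ) : ℝ := 1 / (128 * ((3 : ℝ) ^ ν) ^ 4)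

/-- MODEL (witness data). The perturbative letter `θ := 1∕(16·(3^ν)²)` of the model. [cite: Balaban1988RG2Cluster, (2.24) p.17] -/
def thetaW (ν : ℕ) : ℝ := 1 / (16 * ((3 : ℝ) ^ ν) ^ 2)

variable (ν : ℕ)

/-- `1 ≤ 3^ν`. [folklore] -/
private theorem three_pow_ge_one : 1 ≤ (3 : ℝ) ^ ν := one_le_pow₀ (by norm_num)

/-- `0 < ρ_b`: the `b`-ball of the model is NOT empty. [cite: Balaban1988RG2Cluster, (2.24) p.17] -/
theorem rhoB_pos : 0 < rhoB ν := by unfold rhoB; positivity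

/-- `0 < θ`. [cite: Balaban1988RG2Cluster, (2.24) p.17] -/
theorem thetaW_pos : 0 < thetaW ν := by unfold thetaW; positivity

/-- `ρ_b ≤ 1∕128`. [cite: Balaban1988RG2Cluster, (2.24) p.17] -/
theorem rhoB_le : rhoB ν ≤ 1 / 128 := by
  have hu := three_pow_ge_one ν
  unfold rhoB
  rw [div_le_div_iff₀ (by positivity) (by norm_num), one_mul, one_mul]
  nlinarith [one_le_pow₀ (M₀ := ℝ) (n := 4) hu]

/-- `3ρ_b ≤ θ` and `ρ_b∕2 ≤ θ`. [cite: Balaban1988RG2Cluster, (2.24) p.17] -/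
theorem rhoB_le_thetaW : 3 * rhoB ν ≤ thetaW ν ∧ rhoB ν / 2 ≤ thetaW ν := by
  have hu := three_pow_ge_one ν
  set u := (3 : ℝ) ^ ν with hu_def
  have h4 : (1 : ℝ) ≤ u ^ 2 := one_le_pow₀ hu
  have key : 3 * rhoB ν ≤ thetaW ν := by
    unfold rhoB thetaW
    rw [← hu_def, mul_one_div, div_le_div_iff₀ (by positivity) (by positivity)]
    nlinarith [h4, sq_nonneg u]
  refine ⟨key, le_trans ?_ key⟩
  have := rhoB_pos ν
  linarith

/-- The ν-dependent fibre factors of the capstone at the model rates `κ = 3, κ′ = 2, κ″ = 1`, `m = 1`: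
all four equal `3^ν` but the first, `(5∕3)^ν ≤ 3^ν`. [cite: Balaban1988RG2Cluster, (2.24) p.17] -/
theorem fibreFactors_model :
    ((1 : ℕ) : ℝ) * (1 + 2 / (3 - 2)) ^ ν = (3 : ℝ) ^ ν ∧ ((1 : ℕ) : ℝ) * (1 + 2 / (2 - 1)) ^ ν = (3 : ℝ) ^ ν ∧
    ((1 : ℕ) : ℝ) * (1 + 2 / 1) ^ ν = (3 : ℝ) ^ ν ∧ ((1 : ℕ) : ℝ) * (1 + 2 / 3) ^ ν ≤ (3 : ℝ) ^ ν ∧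
    0 ≤ ((1 : ℕ) : ℝ) * (1 + 2 / 3) ^ ν := by
  refine ⟨by norm_num, by norm_num, by norm_num, ?_, by positivity⟩
  rw [Nat.cast_one, one_mul]
  exact pow_le_pow_left₀ (by norm_num) (by norm_num) ν

/-- The R1-letter condition of the capstone at the model: `3^ν·3^ν·(ρ_b∕2·4·1 + ½·10ρ_b·1 + ½·1·ρ_b∕2) ≤ θ`.
[cite: Balaban1988RG2Cluster, (2.24) p.17] -/
theorem hθR1le_model :
    ((1 : ℕ) : ℝ) * (1 + 2 / (3 - 2)) ^ ν * (((1 : ℕ) : ℝ) * (1 + 2 / (2 - 1)) ^ ν)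
      * (rhoB ν / 2 * 4 * 1 + 1 / 2 * (10 * rhoB ν) * 1 + 1 / 2 * 1 * (rhoB ν / 2)) ≤ thetaW ν := by
  obtain ⟨h1, h2, -, -, -⟩ := fibreFactors_model ν
  rw [h1, h2]
  have hu := three_pow_ge_one ν
  set u := (3 : ℝ) ^ ν with hu_def
  have hρ : u * u * (rhoB ν / 2 * 4 * 1 + 1 / 2 * (10 * rhoB ν) * 1 + 1 / 2 * 1 * (rhoB ν / 2))
      = 29 / 512 * (1 / u ^ 2) := by
    unfold rhoB; rw [← hu_def]; field_simp; ring
  have hθ : thetaW ν = 32 / 512 * (1 / u ^ 2) := by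
    unfold thetaW; rw [← hu_def]; field_simp; ring
  rw [hρ, hθ]
  exact mul_le_mul_of_nonneg_right (by norm_num) (by positivity)

/-- The smallness `K₀·F₀·θ·F″ < 1` of the capstone at the model (indeed `≤ 1∕16`). [cite: Balaban1988RG2Cluster, (2.24) p.17] -/
theorem hsmallKθ_model :
    1 * (((1 : ℕ) : ℝ) * (1 + 2 / 3) ^ ν) * (thetaW ν * (((1 : ℕ) : ℝ) * (1 + 2 / 1) ^ ν)) ≤ 1 / 16 ∧
    1 * (((1 : ℕ) : ℝ) * (1 + 2 / 3) ^ ν) * (thetaW ν * (((1 : ℕ) : ℝ) * (1 + 2 / 1) ^ ν)) < 1 := by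
  obtain ⟨-, -, h3, h4, h5⟩ := fibreFactors_model ν
  have hu := three_pow_ge_one ν
  have hθ := thetaW_pos ν
  have key : 1 * (((1 : ℕ) : ℝ) * (1 + 2 / 3) ^ ν) * (thetaW ν * (((1 : ℕ) : ℝ) * (1 + 2 / 1) ^ ν)) ≤ 1 / 16 := by
    rw [h3, one_mul]
    calc ((1 : ℕ) : ℝ) * (1 + 2 / 3) ^ ν * (thetaW ν * (3 : ℝ) ^ ν)
        ≤ (3 : ℝ) ^ ν * (thetaW ν * (3 : ℝ) ^ ν) := mul_le_mul_of_nonneg_right h4 (by positivity)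
      _ = 1 / 16 := by unfold thetaW; field_simp
  exact ⟨key, key.trans_lt (by norm_num)⟩

/-- `2θ·F″ ≤ ⅛` at the model. [cite: Balaban1988RG2Cluster, (2.24) p.17] -/
theorem two_theta_F_le : 2 * (thetaW ν * (((1 : ℕ) : ℝ) * (1 + 2 / 1) ^ ν)) ≤ 1 / 8 := by
  obtain ⟨-, -, h3, -, -⟩ := fibreFactors_model ν
  rw [h3]
  have hu := three_pow_ge_one ν
  set u := (3 : ℝ) ^ ν with hu_def
  have h : 2 * (thetaW ν * u) = 1 / (8 * u) := by
    unfold thetaW; rw [← hu_def]; field_simp; ring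
  rw [h]
  exact one_div_le_one_div_of_le (by norm_num) (by linarith)

/-- The letter transports of `B13Term214WindowDilated` §2 at the model: `(1 + ρ_b)·½ ≤ 1`, `(1 − ρ_b)⁻²·1 ≤ 4`,
`ρ_b(2 + ρ_b)(1 − ρ_b)⁻²·1 ≤ 10ρ_b`, `ρ_b(2 + ρ_b)·1 ≤ 3ρ_b`, `(1 + ρ_b)² ≤ 2`, `ρ_b < 1`. [cite: Balaban1988RG2Cluster, (2.24) p.17] -/
theorem transports_model :
    rhoB ν < 1 ∧ (1 + rhoB ν) * (1 / 2) ≤ 1 ∧ ((1 - rhoB ν) ^ 2)⁻¹ * 1 ≤ 4 ∧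
    0 + rhoB ν * (1 / 2) ≤ rhoB ν / 2 ∧
    0 + rhoB ν * (2 + rhoB ν) * ((1 - rhoB ν) ^ 2)⁻¹ * 1 ≤ 10 * rhoB ν ∧
    0 + rhoB ν * (2 + rhoB ν) * (0 + 1) ≤ 3 * rhoB ν ∧ (1 + rhoB ν) ^ 2 ≤ 2 := by
  have h0 := rhoB_pos ν
  have h1 := rhoB_le ν
  have hinv : ((1 - rhoB ν) ^ 2)⁻¹ ≤ 4 := by
    calc ((1 - rhoB ν) ^ 2)⁻¹ ≤ ((1 / 4 : ℝ))⁻¹ := inv_anti₀ (by norm_num) (by nlinarith)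
      _ = 4 := by norm_num
  refine ⟨by linarith, by linarith, by linarith, by linarith, ?_, by nlinarith, by nlinarith⟩
  have h2 : rhoB ν * (2 + rhoB ν) ≤ rhoB ν * (5 / 2) := mul_le_mul_of_nonneg_left (by linarith) h0.le
  calc 0 + rhoB ν * (2 + rhoB ν) * ((1 - rhoB ν) ^ 2)⁻¹ * 1
      = rhoB ν * (2 + rhoB ν) * ((1 - rhoB ν) ^ 2)⁻¹ := by ring
    _ ≤ rhoB ν * (5 / 2) * 4 := mul_le_mul h2 hinv (by positivity) (by positivity)
    _ = 10 * rhoB ν := by ring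

end Numbers

/-! ## §4. The τ-regions and the (2.20) constants of the model on the two-scale torus -/

section Regions

variable {d L N' : ℕ} [NeZero L] [NeZero N'] {M : ℕ}

/-- MODEL (witness data). The radius of the τ-disc of a domain: `R_τ(Y) := |τ(Y)| + e^{κ₁} + 1` (`1∕|τ(Y)|` = (2.18)), so that
the disc contains the (2.18) contour and every Cauchy circle of radius `e^{κ₁} − 1` centred on `[0,1]`.
[cite: Balaban1988RG2Cluster, (2.18) p.16] -/
def Rτ (c : B13.Consts) (Y : TDom d (L * N')) : ℝ := (invTau c ((tsys d (L * N')).dj Y))⁻¹ + Real.exp c.κ₁ + 1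

/-- MODEL (witness data). The sum of the τ-radii over the domains of the term: `S := Σ_{Y∈𝐃} R_τ(Y)`.
[cite: Balaban1988RG2Cluster, (2.20) p.16] -/
def SR (c : B13.Consts) (t : Finset (TDom d (L * N')) × Finset (TBond d M (L * N'))) : ℝ := ∑ Y ∈ t.1, Rτ c Y

/-- MODEL (witness data). The Wilson coefficient of the model potentials: `η := 1∕(64(S + 1))`, so that the (2.20) rate
`a₂₀ = 2ηS ≤ 1∕32`. [cite: Balaban1988RG2Cluster, (2.20) p.16] -/
def etaW (c : B13.Consts) (t : Finset (TDom d (L * N')) × Finset (TBond d M (L * N'))) : ℝ := 1 / (64 * (SR c t + 1))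

variable (c : B13.Consts) (t : Finset (TDom d (L * N')) × Finset (TBond d M (L * N')))

/-- `R_τ(Y) > 0` under the (2.18) law `|τ(Y)|⁻¹… > 0`. [cite: Balaban1988RG2Cluster, (2.18) p.16] -/
theorem Rτ_pos (hτ : ∀ x : ℝ, 0 ≤ x → 0 < invTau c x ∧ invTau c x ≤ 1 / 2) (Y : TDom d (L * N')) : 0 < Rτ c Y := by
  have h := (hτ _ ((tsys d (L * N')).dj_nonneg Y)).1
  unfold Rτ
  have := Real.exp_pos c.κ₁
  have := inv_pos.mpr h
  linarith

/-- `S ≥ 0`. [cite: Balaban1988RG2Cluster, (2.20) p.16] -/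
theorem SR_nonneg (hτ : ∀ x : ℝ, 0 ≤ x → 0 < invTau c x ∧ invTau c x ≤ 1 / 2) : 0 ≤ SR c t :=
  Finset.sum_nonneg fun Y _ => (Rτ_pos c hτ Y).le

/-- `η > 0` (the model potentials are NOT zero) and the (2.20) constants: `2ηS ≤ 1∕32`.
[cite: Balaban1988RG2Cluster, (2.20) p.16] -/
theorem etaW_pos_and_rate (hτ : ∀ x : ℝ, 0 ≤ x → 0 < invTau c x ∧ invTau c x ≤ 1 / 2) :
    0 < etaW c t ∧ 2 * (etaW c t * SR c t) ≤ 1 / 32 := by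
  have hS := SR_nonneg c t hτ
  have hη : 0 < etaW c t := by unfold etaW; positivity
  refine ⟨hη, ?_⟩
  have h1 : etaW c t * SR c t ≤ etaW c t * (SR c t + 1) := mul_le_mul_of_nonneg_left (by linarith) hη.le
  have h2 : etaW c t * (SR c t + 1) = 1 / 64 := by
    unfold etaW; field_simp
  linarith

end Regions

/-! ## §5. Shared discharges: the located kernel letters of the model, its regions, and the volume condition -/

section Shared

variable {ν : ℕ} (Nf : Fin ν → ℕ) [∀ i, NeZero (Nf i)]

/-- THE LOCATED KERNEL LETTERS OF THE MODEL, in the binder shapes of the capstone (every bond at the base site, so every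
(L17a)-weight is `1`): `|G| ≤ ½`, `|Γ₀| ≤ ½`, `|A⁻¹| ≤ 1`, `|C| ≤ 1`, `|C⁻¹| ≤ 1`, and the three (L16a) differences are `0`
(`G = Γ₀`, `A⁻¹ = C`, `A = C⁻¹`). [cite: Balaban1988RG2Cluster, (2.16)–(2.17) p.16] -/
theorem letters_model {ι : Type*} :
    (∀ σ : ι → ℂ, (∀ j, σ j ∈ (Set.univ : Set ℂ)) →
      ∀ b j, ‖Gm b j‖ ≤ 1 / 2 * Real.exp (-(3 * tdist1 Nf (x0 Nf) (x0 Nf)))) ∧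
    (∀ b j, ‖Gam0 b j‖ ≤ 1 / 2 * Real.exp (-(3 * tdist1 Nf (x0 Nf) (x0 Nf)))) ∧
    (∀ σ : ι → ℂ, (∀ j, σ j ∈ (Set.univ : Set ℂ)) →
      ∀ b b', ‖((fun _ : ι → ℂ => (1 : Matrix (Fin 1) (Fin 1) ℂ)) σ)⁻¹ b b'‖
        ≤ 1 * Real.exp (-(3 * tdist1 Nf (x0 Nf) (x0 Nf)))) ∧
    (∀ b b' : Fin 1, ‖(1 : Matrix (Fin 1) (Fin 1) ℝ) b b'‖ ≤ 1 * Real.exp (-(3 * tdist1 Nf (x0 Nf) (x0 Nf)))) ∧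
    (∀ b b' : Fin 1, ‖((1 : Matrix (Fin 1) (Fin 1) ℝ)⁻¹.map (algebraMap ℝ ℂ)) b b'‖
      ≤ 1 * Real.exp (-(3 * tdist1 Nf (x0 Nf) (x0 Nf)))) ∧
    (∀ σ : ι → ℂ, (∀ j, σ j ∈ (Set.univ : Set ℂ)) →
      ∀ b j, ‖((fun _ : ι → ℂ => Gm) σ - Gam0.map (algebraMap ℝ ℂ)) b j‖
        ≤ 0 * Real.exp (-(3 * tdist1 Nf (x0 Nf) (x0 Nf)))) ∧
    (∀ σ : ι → ℂ, (∀ j, σ j ∈ (Set.univ : Set ℂ)) →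
      ∀ b b', ‖(((fun _ : ι → ℂ => (1 : Matrix (Fin 1) (Fin 1) ℂ)) σ)⁻¹
          - (1 : Matrix (Fin 1) (Fin 1) ℝ).map (algebraMap ℝ ℂ)) b b'‖
        ≤ 0 * Real.exp (-(3 * tdist1 Nf (x0 Nf) (x0 Nf)))) ∧
    (∀ σ : ι → ℂ, (∀ j, σ j ∈ (Set.univ : Set ℂ)) →
      ∀ b b', ‖((fun _ : ι → ℂ => (1 : Matrix (Fin 1) (Fin 1) ℂ)) σ
          - (1 : Matrix (Fin 1) (Fin 1) ℝ)⁻¹.map (algebraMap ℝ ℂ)) b b'‖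
        ≤ 0 * Real.exp (-(3 * tdist1 Nf (x0 Nf) (x0 Nf)))) := by
  have hw1 := exp_tdist1_x0 Nf (3 : ℝ)
  have hone : ∀ b b' : Fin 1, ‖(1 : Matrix (Fin 1) (Fin 1) ℂ) b b'‖ ≤ 1 * Real.exp (-(3 * tdist1 Nf (x0 Nf) (x0 Nf))) := by
    intro b b'
    obtain rfl : b = b' := Subsingleton.elim _ _
    rw [hw1, Matrix.one_apply_eq, norm_one, mul_one]
  have hmap1 : ((1 : Matrix (Fin 1) (Fin 1) ℝ)).map (algebraMap ℝ ℂ) = 1 :=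
    Matrix.map_one _ (map_zero _) (map_one _)
  refine ⟨fun _ _ b j => ?_, fun b j => ?_, fun _ _ b b' => ?_, fun b b' => ?_, fun b b' => ?_, fun _ _ b j => ?_,
    fun _ _ b b' => ?_, fun _ _ b b' => ?_⟩
  · rw [hw1, (norm_Gm b j).1, mul_one]
  · rw [hw1, (norm_Gm b j).2, mul_one]
  · rw [inv_one]; exact hone b b'
  · obtain rfl : b = b' := Subsingleton.elim _ _
    rw [hw1, Matrix.one_apply_eq, norm_one, mul_one]
  · rw [inv_one, hmap1]; exact hone b b'
  · simp [Gm]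
  · rw [hmap1, inv_one, sub_self]; simp
  · rw [inv_one, hmap1, sub_self]; simp

variable {d L N' : ℕ} [NeZero L] [NeZero N'] {M : ℕ}

/-- THE REGIONS OF THE MODEL, in the binder shapes of the capstone: the (2.18) law on the torus (`0 < 1∕|τ(Y)| ≤ ½`), the
Cauchy radius `e^{κ₁} − 1 > 0`, and the τ-discs `ball 0 R_τ(Y)` containing the (2.18) contour disc and every Cauchy circle
centred on `[0,1]`. [cite: Balaban1988RG2Cluster, (2.14) p.15, (2.18) p.16] -/
theorem regions_model (c : B13.Consts) (hκ₁ : 1 ≤ c.κ₁) (hτ : ∀ x : ℝ, 0 ≤ x → 0 < invTau c x ∧ invTau c x ≤ 1 / 2) :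
    (∀ Y : TDom d (L * N'), 0 < invTau c ((tsys d (L * N')).dj Y)) ∧
    (∀ Y : TDom d (L * N'), invTau c ((tsys d (L * N')).dj Y) ≤ 1 / 2) ∧
    0 < Real.exp c.κ₁ - 1 ∧
    (∀ Y : TDom d (L * N'), closedBall (0 : ℂ) ((invTau c ((tsys d (L * N')).dj Y))⁻¹) ⊆ ball (0 : ℂ) (Rτ c Y)) ∧
    (∀ Y : TDom d (L * N'), ∀ s ∈ Set.uIcc (0 : ℝ) 1, closedBall (s : ℂ) (Real.exp c.κ₁ - 1) ⊆ ball (0 : ℂ) (Rτ c Y)) := by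
  have hexp1 : 1 < Real.exp c.κ₁ := Real.one_lt_exp_iff.mpr (by linarith)
  refine ⟨fun Y => (hτ _ ((tsys d (L * N')).dj_nonneg Y)).1, fun Y => (hτ _ ((tsys d (L * N')).dj_nonneg Y)).2,
    by linarith, fun Y => closedBall_subset_ball (by unfold Rτ; linarith [Real.exp_pos c.κ₁]), fun Y s hs => ?_⟩
  rw [Set.uIcc_of_le zero_le_one] at hs
  refine closedBall_subset_ball' ?_
  have hds : dist (s : ℂ) 0 ≤ 1 := by
    rw [dist_zero_right, Complex.norm_real, Real.norm_of_nonneg hs.1]; exact hs.2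
  have := inv_pos.mpr (hτ _ ((tsys d (L * N')).dj_nonneg Y)).1
  unfold Rτ; linarith

/-- THE VOLUME CONDITION `hvol` OF THE CAPSTONE AT THE MODEL, with an additive letter `w ≥ 0` (`w′ = 4S` for the members,
`w₀ = S` for the box tail) and `a₅ := 1 + w`: the left side is `≤ 13∕16 + w ≤ (1 + w)|Z|` (`|Z| ≥ 1`).
[cite: Balaban1988RG2Cluster, (2.26) p.17 («exp O(1)α₅|Z|»)] -/
theorem vol_model (ν : ℕ) {w Zc : ℝ} (hw : 0 ≤ w) (hZ : 1 ≤ Zc) :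
    2 * (1 * (((1 : ℕ) : ℝ) * (1 + 2 / 3) ^ ν) * (thetaW ν * (((1 : ℕ) : ℝ) * (1 + 2 / 1) ^ ν))
              * (1 + (1 - 1 * (((1 : ℕ) : ℝ) * (1 + 2 / 3) ^ ν) * (thetaW ν * (((1 : ℕ) : ℝ) * (1 + 2 / 1) ^ ν)))⁻¹) / 2)
          * (Fintype.card (Fin 1) : ℝ)
        + w + (2 * (thetaW ν * (((1 : ℕ) : ℝ) * (1 + 2 / 1) ^ ν)) + (1 / 16 + 1 / 16)) * 1 * (Fintype.card (Fin 1) : ℝ)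
        + (2 * (thetaW ν * (((1 : ℕ) : ℝ) * (1 + 2 / 1) ^ ν)) + (1 / 16 + 1 / 16)) * (1 + 2 * 1 * (1 / 4))
          * (Fintype.card (Fin 1 ⊕ Fin 0) : ℝ)
        ≤ (1 + w) * Zc := by
  obtain ⟨hx16, -⟩ := hsmallKθ_model ν
  have h2θ := two_theta_F_le ν
  set x := 1 * (((1 : ℕ) : ℝ) * (1 + 2 / 3) ^ ν) * (thetaW ν * (((1 : ℕ) : ℝ) * (1 + 2 / 1) ^ ν)) with hx
  have hx0 : 0 ≤ x := by rw [hx]; have := (thetaW_pos ν).le; positivity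
  have hinv : (1 - x)⁻¹ ≤ 2 := by
    calc (1 - x)⁻¹ ≤ ((1 / 2 : ℝ))⁻¹ := inv_anti₀ (by norm_num) (by linarith)
      _ = 2 := by norm_num
  have hfirst : 2 * (x * (1 + (1 - x)⁻¹)) / 2 ≤ 3 / 16 := by
    have : x * (1 + (1 - x)⁻¹) ≤ x * 3 := mul_le_mul_of_nonneg_left (by linarith) hx0
    linarith
  simp only [Fintype.card_fin, Fintype.card_sum, Nat.cast_one, add_zero, mul_one]
  nlinarith [hfirst, h2θ, hZ]

end Shared

/-! ## §6. THE WITNESS: the full binder list of `h226_torus_windowDilated_of_primitives` is met at the model -/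

section Witness

variable {d L N' : ℕ} [NeZero L] [NeZero N'] {M : ℕ}

open Classical in
/-- **JOINT SATISFIABILITY OF THE (2.26) CAPSTONE's BINDER LIST ALONG THE WINDOW-DILATED FAMILY (A2 ∕ A6 WITNESS).**  For
EVERY constants record `c` with `κ₁ ≥ 1`, `α₆ ≠ 0` and the (2.18) law `0 < 1∕|τ|(d) ≤ ½` (d ≥ 0) — e.g. the record of
`B13ChainJointNonvacuity.chain_joint_nonvacuous`, see `exists_consts_model` — EVERY two-scale torus geometry `(d, L, N′, M)`,
EVERY site torus `(ν, Nf)`, EVERY block `Z`, EVERY term label `t = (𝐃, P)` (with or without large-field boxes) and EVERY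
large-field radius `r_P`, ALL hypotheses of `B13Term214WindowDilated.h226_torus_windowDilated_of_primitives` hold
SIMULTANEOUSLY at the explicit one-bond model (`Λ = Fin 1`, `C₀ = Fin 0`; σ-polydisc `univ`, τ-discs `ball 0 R_τ(Y)`,
Cauchy radius `e^{κ₁} − 1`; `A(σ) = 1 = C`, `Γ(σ)X = G·X`, `G = Γ₀ ≡ ½`; `χ_{Y₀} = 𝟙{⟨B,B⟩ < r_P²|P| + 1}`,
`χᶜ_P = 𝟙{r_P²|P| ≤ ⟨B,B⟩}`, `q_P = ⟨B,B⟩`, `γ₂ = 1∕16`; potentials `W(Y,B) = η⟨B,B⟩`, `O(Y,B) = 1` on `𝐃`, `a₂₀ = 2ηS`,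
`w = S`; bonds at the base site, `m = 1`; rates `3 > 2 > 1`; letters `θ_E = θ_Γ = θ_C = 0`, `K_G = K_Γ = ½`,
`K_{Cσ} = K₀ = K_E = 1`; `ρ_b = 1∕(128·81^ν) > 0`; primed letters `K_G′ = 1, K_{Cσ}′ = 4, θ_Γ′ = ρ_b∕2, θ_C′ = 10ρ_b,
θ_E′ = 3ρ_b, a′ = 1∕16, w′ = 4S`; `θ = 1∕(16·9^ν)`; `c_E = 1`, `g = ¼`; `a = γ₂r_P²`, `a₅ = 1 + 4S`) — certified by the
kernel: this theorem IS that engine applied with every binder discharged, so its conclusion holds for the model on the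
NON-EMPTY ball `|b − 1| < ρ_b` (`one_mem_ball_rhoB`).  HONEST LABEL: the model kernels are σ-constant (off `Z′₀` the model
term is then the zero term, `B13SigmaFreeKernels.term214_sigmaFree`); what is certified is the joint CONSISTENCY of the
binder list, each `∀`-binder ranging over a non-empty domain (`exists_chi_mul_eq_one`, `etaW_pos_and_rate`,
`one_mem_ball_rhoB`); nothing of Bałaban's is asserted.
[cite: Balaban1988RG2Cluster, (2.14)–(2.15) p.15, (2.16)–(2.22) p.16, (2.23)–(2.26) p.17; Balaban1987RG1, (2.10)-(2.12) pp.267-268] -/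
theorem h226_windowDilated_model {ν : ℕ} (Nf : Fin ν → ℕ) [∀ i, NeZero (Nf i)] (c : B13.Consts) (hκ₁ : 1 ≤ c.κ₁)
    (hα₆ : c.α₆ ≠ 0) (hτ : ∀ x : ℝ, 0 ≤ x → 0 < invTau c x ∧ invTau c x ≤ 1 / 2)
    (Z : TDom d N') (t : Finset (TDom d (L * N')) × Finset (TBond d M (L * N'))) (rP : ℝ) :
    ∀ b ∈ ball (1 : ℂ) (rhoB ν),
      ‖term214 (Real.exp c.κ₁ - 1) (Z.1 \ tclosure L N' (Z0 M t)).toList t.1.toList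
          (core214 (fun _ => b ^ 2 • (1 : Matrix (Fin 1) (Fin 1) ℂ)) (fun _ X => b • Γm X)
            (F214 t.2.card (chiS (rP ^ 2 * t.2.card + 1)) (chiL (rP ^ 2 * t.2.card)) t.1
              (fun Y B => b ^ 2 * Wq (etaW c t) Y B + Oc 1 Y B))) 0 0‖ ≤
        weight L M c Z (1 / 16 * rP ^ 2) t * Real.exp ((1 + 4 * SR c t) * ((Z.1).card : ℝ)) := by
  obtain ⟨hpos, hhalf, hr, hUtau, hsubτ⟩ := regions_model c hκ₁ hτ (d := d) (L := L) (N' := N')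
  have hS := SR_nonneg c t hτ
  obtain ⟨hη, hrate⟩ := etaW_pos_and_rate c t hτ
  obtain ⟨⟨hρ1, hKG', hKCs', hθΓ', hθC', hθE', hsq2⟩, ⟨hθEle, hθΓle⟩, ⟨-, hsmallKθ⟩, h2θ⟩ :=
    And.intro (transports_model ν) (And.intro (rhoB_le_thetaW ν) (And.intro (hsmallKθ_model ν) (two_theta_F_le ν)))
  obtain ⟨hG, hΓ₀, hCs, hC216, hCE, hdΓ, hdC, hdE⟩ := letters_model Nf (ι := TPt d N')
  have hZ1 : (1 : ℝ) ≤ ((Z.1).card : ℝ) := by exact_mod_cast Finset.card_pos.mpr Z.2.1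
  have hvol := vol_model ν (by positivity : (0 : ℝ) ≤ 4 * SR c t) hZ1
  intro b hb
  exact h226_torus_windowDilated_of_primitives c hκ₁ hα₆ Z t hpos hhalf (Uσ := Set.univ)
    (Uτ := fun Y => ball (0 : ℂ) (Rτ c Y)) isOpen_univ (fun _ => isOpen_ball) (Set.subset_univ _) hUtau hr le_rfl hsubτ
    _ ⟨Finset.nodup_toList _, Finset.toList_toFinset _⟩ _ ⟨Finset.nodup_toList _, Finset.toList_toFinset _⟩
    (fun _ => (1 : Matrix (Fin 1) (Fin 1) ℂ)) (fun _ X => Γm X) (chiS (rP ^ 2 * t.2.card + 1)) (chiL (rP ^ 2 * t.2.card))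
    (chiS_nonneg _) (chiL_nonneg _) t.1 (Wq (etaW c t)) (Oc 1) Matrix.PosDef.one Gam0
    (fun _ _ => differentiableOn_const _) (measurable_chiS _) (measurable_chiL _) (fun Y => measurable_Wq _ Y)
    (fun Y => measurable_Oc _ Y) (fun _ _ => Matrix.isSymm_one) (fun _ => Gm) (fun _ _ => differentiableOn_const _)
    (fun _ _ _ => rfl) (γ₂ := 1 / 16) (rP := rP) (a₂₀ := 2 * (etaW c t * SR c t)) (w := 1 * SR c t) (fun B => B ⬝ᵥ B)
    (fun B => h222_model _ (by norm_num) rP t.2.card B) (by norm_num) (fun _ => le_rfl) (by positivity)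
    (fun τ hτ' B => h220_model t.1 hη.le zero_le_one τ (fun Y _ => (mem_ball_zero_iff.mp (hτ' Y)).le) B)
    (fun _ => x0 Nf) (fun _ => x0 Nf) (m := 1) (fib_model_Λ Nf) (fib_model_N Nf)
    (kap := 3) (kap' := 2) (kap'' := 1) (θ := thetaW ν) (θE := 0) (θΓ := 0) (θC := 0) (KG := 1 / 2) (KΓ := 1 / 2)
    (KCs := 1) (K₀ := 1) (KE := 1) (by norm_num) (by norm_num) (by norm_num) le_rfl le_rfl le_rfl (by norm_num)
    (by norm_num) zero_le_one zero_le_one zero_le_one hG hΓ₀ hCs hC216 hCE hdΓ hdC hdE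
    (ρb := rhoB ν) (KG' := 1) (KCs' := 4) (θΓ' := rhoB ν / 2) (θC' := 10 * rhoB ν) (θE' := 3 * rhoB ν) (a' := 1 / 16)
    (w' := 4 * SR c t) hρ1 hKG' hKCs' hθΓ' hθC' hθE'
    (by nlinarith [hrate, hsq2, hη.le, hS]) (by nlinarith [hsq2, hS]) hθEle hθΓle (hθR1le_model ν) hsmallKθ
    (cE := 1) (g := 1 / 4) zero_le_one (eigenvalues_one_le Matrix.PosDef.one) (by nlinarith [h2θ]) (by norm_num) Gam0_form
    (by nlinarith [h2θ]) (a := 1 / 16 * rP ^ 2) (a₅ := 1 + 4 * SR c t) le_rfl hvol b hb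

open Classical in
/-- **THE SAME AT A LABEL WITHOUT LARGE-FIELD BOXES, WITH THE BOX LAW: the full binder list of the box-tail engine
`B13Bound226BoxTail.h226_torus_windowDilated_boxTail_of_primitives` is met at the model** — at a term label with `|P| = 0`
the model's `χ_{Y₀}χᶜ_P = 𝟙{⟨B,B⟩ < 1}·1` obeys `0 ≤ χχᶜ ≤ 1` AND the box law `χχᶜ = 1` on `⟨B,B⟩ < 1²` (`boxLaw_model`);
the centre's potentials are the field-constant `𝐕₀(Y,B) = 1` with `Σ|τ||𝐕₀| ≤ ½a₀⟨B,B⟩ + S` (`a₀ = 1∕16`); box-tail rate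
`κ = 1∕16`; every other binder as in `h226_windowDilated_model`.  So the box law and the rest of the list are jointly
consistent where print uses them together (`P = ∅`).  Same honest label (σ-constant kernels; consistency is what is certified).
[cite: Balaban1988RG2Cluster, (2.14)–(2.15) p.15, (2.16)–(2.22) p.16, (2.23)–(2.26) p.17; Balaban1987RG1, (2.10)-(2.13) pp.267-268] -/
theorem boxTail_windowDilated_model {ν : ℕ} (Nf : Fin ν → ℕ) [∀ i, NeZero (Nf i)] (c : B13.Consts) (hκ₁ : 1 ≤ c.κ₁)
    (hα₆ : c.α₆ ≠ 0) (hτ : ∀ x : ℝ, 0 ≤ x → 0 < invTau c x ∧ invTau c x ≤ 1 / 2)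
    (Z : TDom d N') (t : Finset (TDom d (L * N')) × Finset (TBond d M (L * N'))) (hP0 : t.2.card = 0) (rP a : ℝ) :
    ∀ b ∈ ball (1 : ℂ) (rhoB ν),
      ‖term214 (Real.exp c.κ₁ - 1) (Z.1 \ tclosure L N' (Z0 M t)).toList t.1.toList
            (core214 (fun _ => b ^ 2 • (1 : Matrix (Fin 1) (Fin 1) ℂ)) (fun _ X => b • Γm X)
              (F214 t.2.card (chiS (rP ^ 2 * t.2.card + 1)) (chiL (rP ^ 2 * t.2.card)) t.1 (Oc 1))) 0 0
          - term214 (Real.exp c.κ₁ - 1) (Z.1 \ tclosure L N' (Z0 M t)).toList t.1.toList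
            (core214 (fun _ => b ^ 2 • (1 : Matrix (Fin 1) (Fin 1) ℂ)) (fun _ X => b • Γm X)
              (F214 t.2.card (fun _ => 1) (fun _ => 1) t.1 (Oc 1))) 0 0‖ ≤
        Real.exp (-(1 / 16 / 2 * (1 : ℝ) ^ 2)) * (weight L M c Z a t * Real.exp ((1 + 1 * SR c t) * ((Z.1).card : ℝ))) := by
  obtain ⟨hpos, hhalf, hr, hUtau, hsubτ⟩ := regions_model c hκ₁ hτ (d := d) (L := L) (N' := N')
  have hS := SR_nonneg c t hτ
  obtain ⟨⟨hρ1, hKG', hKCs', hθΓ', hθC', hθE', hsq2⟩, ⟨hθEle, hθΓle⟩, ⟨-, hsmallKθ⟩, h2θ⟩ :=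
    And.intro (transports_model ν) (And.intro (rhoB_le_thetaW ν) (And.intro (hsmallKθ_model ν) (two_theta_F_le ν)))
  obtain ⟨hG, hΓ₀, hCs, hC216, hCE, hdΓ, hdC, hdE⟩ := letters_model Nf (ι := TPt d N')
  have hZ1 : (1 : ℝ) ≤ ((Z.1).card : ℝ) := by exact_mod_cast Finset.card_pos.mpr Z.2.1
  have hvol := vol_model ν (by positivity : (0 : ℝ) ≤ 1 * SR c t) hZ1
  -- the box law at this label (|P| = 0, radius 1)
  have hbox : ∀ B : Fin 1 → ℝ, B ⬝ᵥ B < (1 : ℝ) ^ 2 →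
      chiS (rP ^ 2 * (t.2.card : ℕ) + 1) B * chiL (rP ^ 2 * (t.2.card : ℕ)) B = 1 := fun B hB => by
    rw [hP0]; exact boxLaw_model _ rP B (by simpa using hB)
  -- the centre's (2.20) letter: Σ|τ||O| ≤ ½a₀⟨B,B⟩ + S
  have h220V : ∀ τ : TDom d (L * N') → ℂ, (∀ Y, τ Y ∈ ball (0 : ℂ) (Rτ c Y)) →
      ∀ B : Fin 1 → ℝ, ∑ Y ∈ t.1, ‖τ Y‖ * ‖Oc (Λ := Fin 1) 1 Y B‖ ≤ 1 / 16 / 2 * (B ⬝ᵥ B) + 1 * SR c t := by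
    intro τ hτ' B
    have h := h220_model t.1 (R := Rτ c) le_rfl zero_le_one τ (fun Y _ => (mem_ball_zero_iff.mp (hτ' Y)).le) B
    have hB : 0 ≤ B ⬝ᵥ B := Finset.sum_nonneg fun i _ => mul_self_nonneg (B i)
    have hWO : ∀ Y, ‖τ Y‖ * ‖Oc (Λ := Fin 1) 1 Y B‖ ≤ ‖τ Y‖ * (‖Wq (Λ := Fin 1) 0 Y B‖ + ‖Oc (Λ := Fin 1) 1 Y B‖) :=
      fun Y => mul_le_mul_of_nonneg_left (le_add_of_nonneg_left (norm_nonneg _)) (norm_nonneg _)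
    calc ∑ Y ∈ t.1, ‖τ Y‖ * ‖Oc (Λ := Fin 1) 1 Y B‖
        ≤ ∑ Y ∈ t.1, ‖τ Y‖ * (‖Wq (Λ := Fin 1) 0 Y B‖ + ‖Oc (Λ := Fin 1) 1 Y B‖) := Finset.sum_le_sum fun Y _ => hWO Y
      _ ≤ 2 * (0 * ∑ Y ∈ t.1, Rτ c Y) / 2 * (B ⬝ᵥ B) + 1 * ∑ Y ∈ t.1, Rτ c Y := h
      _ ≤ 1 / 16 / 2 * (B ⬝ᵥ B) + 1 * SR c t := by unfold SR; nlinarith [hB]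
  intro b hb
  exact h226_torus_windowDilated_boxTail_of_primitives c hκ₁ hα₆ Z t hpos hhalf (Uσ := Set.univ)
    (Uτ := fun Y => ball (0 : ℂ) (Rτ c Y)) isOpen_univ (fun _ => isOpen_ball) (Set.subset_univ _) hUtau hr le_rfl hsubτ
    _ ⟨Finset.nodup_toList _, Finset.toList_toFinset _⟩ _ ⟨Finset.nodup_toList _, Finset.toList_toFinset _⟩
    (fun _ => (1 : Matrix (Fin 1) (Fin 1) ℂ)) (fun _ X => Γm X) (chiS_nonneg _) (chiL_nonneg _)
    (fun B => chiS_mul_chiL_le_one _ _ B) (R := 1) (κ := 1 / 16) (by norm_num) hbox t.1 (V₀ := Oc 1)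
    Matrix.PosDef.one Gam0 (fun _ _ => differentiableOn_const _) (measurable_chiS _) (measurable_chiL _)
    (fun Y => measurable_Oc _ Y) (fun _ _ => Matrix.isSymm_one) (fun _ => Gm) (fun _ _ => differentiableOn_const _)
    (fun _ _ _ => rfl) hP0 (a₀ := 1 / 16) (w₀ := 1 * SR c t) (by norm_num) h220V
    (fun _ => x0 Nf) (fun _ => x0 Nf) (m := 1) (fib_model_Λ Nf) (fib_model_N Nf)
    (kap := 3) (kap' := 2) (kap'' := 1) (θ := thetaW ν) (θE := 0) (θΓ := 0) (θC := 0) (KG := 1 / 2) (KΓ := 1 / 2)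
    (KCs := 1) (K₀ := 1) (KE := 1) (by norm_num) (by norm_num) (by norm_num) le_rfl le_rfl le_rfl (by norm_num)
    (by norm_num) zero_le_one zero_le_one zero_le_one hG hΓ₀ hCs hC216 hCE hdΓ hdC hdE
    (ρb := rhoB ν) (KG' := 1) (KCs' := 4) (θΓ' := rhoB ν / 2) (θC' := 10 * rhoB ν) (θE' := 3 * rhoB ν)
    hρ1 hKG' hKCs' hθΓ' hθC' hθE' hθEle hθΓle (hθR1le_model ν) hsmallKθ
    (cE := 1) (g := 1 / 4) zero_le_one (eigenvalues_one_le Matrix.PosDef.one) (by nlinarith [h2θ]) (by norm_num) Gam0_form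
    (by nlinarith [h2θ]) (a := a) (a₅ := 1 + 1 * SR c t) hvol hb

open Classical in
/-- **THE SAME AT A LARGE-FIELD LABEL, WITH (2.22) AND THE SURPLUS RADIUS: the full binder list of the large-field engine
`B13Bound226BoxTail.h226_torus_windowDilated_largeField_of_primitives` is met at the model** — at a term label with
`|P| ≥ 1` the model's `χ_{Y₀}χᶜ_P = 𝟙{r_P²|P| ≤ ⟨B,B⟩ < r_P²|P| + 1}` obeys (2.22) at radius `r_P` (`h222_model`) and is NOT
identically zero (`exists_chi_mul_eq_one`); smaller radius `r₁` with `r₁² ≤ r_P²`, weight rate `a = γ₂r₁²`; every other binder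
as in `h226_windowDilated_model`.  So (2.22) at `|P| ≥ 1` and the rest of the list are jointly consistent where print uses them
together (`P ≠ ∅`) — and NO box law is among these binders (the box law is a `P = ∅` statement, `boxTail_windowDilated_model`).
Same honest label (σ-constant kernels; consistency is what is certified).
[cite: Balaban1988RG2Cluster, (2.14)–(2.15) p.15, (2.16)–(2.22) p.16, (2.23)–(2.26) p.17; Balaban1987RG1, (2.10)-(2.12) pp.267-268] -/
theorem largeField_windowDilated_model {ν : ℕ} (Nf : Fin ν → ℕ) [∀ i, NeZero (Nf i)] (c : B13.Consts) (hκ₁ : 1 ≤ c.κ₁)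
    (hα₆ : c.α₆ ≠ 0) (hτ : ∀ x : ℝ, 0 ≤ x → 0 < invTau c x ∧ invTau c x ≤ 1 / 2)
    (Z : TDom d N') (t : Finset (TDom d (L * N')) × Finset (TBond d M (L * N'))) (hP1 : 1 ≤ t.2.card)
    {rP r₁ : ℝ} (hr₁ : r₁ ^ 2 ≤ rP ^ 2) :
    ∀ b ∈ ball (1 : ℂ) (rhoB ν),
      ‖term214 (Real.exp c.κ₁ - 1) (Z.1 \ tclosure L N' (Z0 M t)).toList t.1.toList
          (core214 (fun _ => b ^ 2 • (1 : Matrix (Fin 1) (Fin 1) ℂ)) (fun _ X => b • Γm X)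
            (F214 t.2.card (chiS (rP ^ 2 * t.2.card + 1)) (chiL (rP ^ 2 * t.2.card)) t.1
              (fun Y B => b ^ 2 * Wq (etaW c t) Y B + Oc 1 Y B))) 0 0‖ ≤
        Real.exp (-(1 / 16 / 2 * (rP ^ 2 - r₁ ^ 2))) *
          (weight L M c Z (1 / 16 * r₁ ^ 2) t * Real.exp ((1 + 4 * SR c t) * ((Z.1).card : ℝ))) := by
  obtain ⟨hpos, hhalf, hr, hUtau, hsubτ⟩ := regions_model c hκ₁ hτ (d := d) (L := L) (N' := N')
  have hS := SR_nonneg c t hτ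
  obtain ⟨hη, hrate⟩ := etaW_pos_and_rate c t hτ
  obtain ⟨⟨hρ1, hKG', hKCs', hθΓ', hθC', hθE', hsq2⟩, ⟨hθEle, hθΓle⟩, ⟨-, hsmallKθ⟩, h2θ⟩ :=
    And.intro (transports_model ν) (And.intro (rhoB_le_thetaW ν) (And.intro (hsmallKθ_model ν) (two_theta_F_le ν)))
  obtain ⟨hG, hΓ₀, hCs, hC216, hCE, hdΓ, hdC, hdE⟩ := letters_model Nf (ι := TPt d N')
  have hZ1 : (1 : ℝ) ≤ ((Z.1).card : ℝ) := by exact_mod_cast Finset.card_pos.mpr Z.2.1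
  have hvol := vol_model ν (by positivity : (0 : ℝ) ≤ 4 * SR c t) hZ1
  intro b hb
  exact h226_torus_windowDilated_largeField_of_primitives c hκ₁ hα₆ Z t hpos hhalf (Uσ := Set.univ)
    (Uτ := fun Y => ball (0 : ℂ) (Rτ c Y)) isOpen_univ (fun _ => isOpen_ball) (Set.subset_univ _) hUtau hr le_rfl hsubτ
    _ ⟨Finset.nodup_toList _, Finset.toList_toFinset _⟩ _ ⟨Finset.nodup_toList _, Finset.toList_toFinset _⟩
    (fun _ => (1 : Matrix (Fin 1) (Fin 1) ℂ)) (fun _ X => Γm X) (chiS (rP ^ 2 * t.2.card + 1)) (chiL (rP ^ 2 * t.2.card))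
    (chiS_nonneg _) (chiL_nonneg _) t.1 (Wq (etaW c t)) (Oc 1) Matrix.PosDef.one Gam0
    (fun _ _ => differentiableOn_const _) (measurable_chiS _) (measurable_chiL _) (fun Y => measurable_Wq _ Y)
    (fun Y => measurable_Oc _ Y) (fun _ _ => Matrix.isSymm_one) (fun _ => Gm) (fun _ _ => differentiableOn_const _)
    (fun _ _ _ => rfl) (γ₂ := 1 / 16) (a₂₀ := 2 * (etaW c t * SR c t)) (w := 1 * SR c t) (fun B => B ⬝ᵥ B)
    (fun B => h222_model _ (by norm_num) rP t.2.card B) (by norm_num) (fun _ => le_rfl) hr₁ hP1 (by positivity)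
    (fun τ hτ' B => h220_model t.1 hη.le zero_le_one τ (fun Y _ => (mem_ball_zero_iff.mp (hτ' Y)).le) B)
    (fun _ => x0 Nf) (fun _ => x0 Nf) (m := 1) (fib_model_Λ Nf) (fib_model_N Nf)
    (kap := 3) (kap' := 2) (kap'' := 1) (θ := thetaW ν) (θE := 0) (θΓ := 0) (θC := 0) (KG := 1 / 2) (KΓ := 1 / 2)
    (KCs := 1) (K₀ := 1) (KE := 1) (by norm_num) (by norm_num) (by norm_num) le_rfl le_rfl le_rfl (by norm_num)
    (by norm_num) zero_le_one zero_le_one zero_le_one hG hΓ₀ hCs hC216 hCE hdΓ hdC hdE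
    (ρb := rhoB ν) (KG' := 1) (KCs' := 4) (θΓ' := rhoB ν / 2) (θC' := 10 * rhoB ν) (θE' := 3 * rhoB ν) (a' := 1 / 16)
    (w' := 4 * SR c t) hρ1 hKG' hKCs' hθΓ' hθC' hθE'
    (by nlinarith [hrate, hsq2, hη.le, hS]) (by nlinarith [hsq2, hS]) hθEle hθΓle (hθR1le_model ν) hsmallKθ
    (cE := 1) (g := 1 / 4) zero_le_one (eigenvalues_one_le Matrix.PosDef.one) (by nlinarith [h2θ]) (by norm_num) Gam0_form
    (by nlinarith [h2θ]) (a := 1 / 16 * r₁ ^ 2) (a₅ := 1 + 4 * SR c t) le_rfl hvol hb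

end Witness

/-! ## §7. Non-emptiness of the binder domains and the constants record of the chain -/

section NonDegenerate

/-- THE `b`-BALL OF THE MODEL IS NOT EMPTY: the real coupling `b = 1` lies in it. [cite: Balaban1988RG2Cluster, (2.24) p.17] -/
theorem one_mem_ball_rhoB (ν : ℕ) : (1 : ℂ) ∈ ball (1 : ℂ) (rhoB ν) := mem_ball_self (rhoB_pos ν)

/-- THE MODEL's CROSS OPERATOR IS NOT ZERO: `ΓX ≠ 0` at `X ≡ 1`. [cite: Balaban1988RG2Cluster, (2.14) p.15] -/
theorem Γm_ne_zero : Γm (fun _ => 1) ≠ 0 := by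
  intro h
  have h0 := congrFun h 0
  simp [Γm, Gm, Gam0, Matrix.mulVec, dotProduct] at h0

/-- **THE CONSTANTS RECORD OF THE N10 CHAIN MEETS THE THREE `c`-HYPOTHESES OF THE WITNESSES** (`κ₁ ≥ 1`, `α₆ ≠ 0`, the
(2.18) law), with print's `q = 8` and R12 — from `B13ChainJointNonvacuity.chain_joint_nonvacuous`.  So the witnesses above are
themselves non-vacuous in `c`, jointly with the 69 numeric conjuncts of the N10 torus chain.
[cite: Balaban1988RG2Cluster, p.16 (after (2.18)) and p.21 (closing paragraph)] -/
theorem exists_consts_model : ∃ c : B13.Consts, c.q = 8 ∧ B13Bound143.R12 c ∧ 1 ≤ c.κ₁ ∧ c.α₆ ≠ 0 ∧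
    (∀ x : ℝ, 0 ≤ x → 0 < invTau c x ∧ invTau c x ≤ 1 / 2) := by
  obtain ⟨c, ⟨hq, hR12, -⟩, -, hC⟩ := B13ChainJointNonvacuity.chain_joint_nonvacuous
  obtain ⟨-, -, -, hα₆, -, -, -, -, -, -, -, -, -, -, -, -, -, -, -, -, -, -, -, -, -, -, -, -, -, -, -, -, -, -, -, -, -, -, -, hκ₁, hτ⟩ := hC
  exact ⟨c, hq, hR12, hκ₁, hα₆.ne', hτ⟩

variable {d L N' : ℕ} [NeZero L] [NeZero N'] {M : ℕ}

open Classical in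
/-- **COROLLARY (existential form of the witness):** there IS a constants record (print's `q = 8`, R12) at which, on every
torus, for every block, term label and large-field radius, the (2.26) capstone's full binder list is met by the model — the
conclusion of `h226_windowDilated_model` holds on the non-empty `b`-ball.
[cite: Balaban1988RG2Cluster, (2.26) p.17, p.21 (closing paragraph)] -/
theorem exists_consts_h226_windowDilated_model {ν : ℕ} (Nf : Fin ν → ℕ) [∀ i, NeZero (Nf i)] :
    ∃ c : B13.Consts, c.q = 8 ∧ B13Bound143.R12 c ∧
      ∀ (Z : TDom d N') (t : Finset (TDom d (L * N')) × Finset (TBond d M (L * N'))) (rP : ℝ),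
        ∀ b ∈ ball (1 : ℂ) (rhoB ν),
          ‖term214 (Real.exp c.κ₁ - 1) (Z.1 \ tclosure L N' (Z0 M t)).toList t.1.toList
              (core214 (fun _ => b ^ 2 • (1 : Matrix (Fin 1) (Fin 1) ℂ)) (fun _ X => b • Γm X)
                (F214 t.2.card (chiS (rP ^ 2 * t.2.card + 1)) (chiL (rP ^ 2 * t.2.card)) t.1
                  (fun Y B => b ^ 2 * Wq (etaW c t) Y B + Oc 1 Y B))) 0 0‖ ≤
            weight L M c Z (1 / 16 * rP ^ 2) t * Real.exp ((1 + 4 * SR c t) * ((Z.1).card : ℝ)) := by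
  obtain ⟨c, hq, hR12, hκ₁, hα₆, hτ⟩ := exists_consts_model
  exact ⟨c, hq, hR12, fun Z t rP => h226_windowDilated_model Nf c hκ₁ hα₆ hτ Z t rP⟩

end NonDegenerate

/-! ## §8 (v1.1, append-only). The LOCAL-GROWTH editions (`B13Term214WindowDilatedUnscaled` §2 members, §5 `P ≠ ∅`) at the
model: cubic Wilson part, affine older part, box-SUPPORT law, per-bond rate -/

section LocalGrowthModel

/-- MODEL (witness data). The coupling-free Wilson part: the cubic `𝒲(Y,A) := κ₃·A₀³`. [cite: Balaban1987RG1, (2.8)-(2.10) pp.266-267] -/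
def Wc {D : Type*} (κ₃ : ℝ) (_Y : D) (A : Fin 1 → ℝ) : ℂ := ((κ₃ * A 0 ^ 3 : ℝ) : ℂ)

/-- MODEL (witness data). The coupling-free older part of the model: the affine `𝒪(Y,A) := 1 + κ₁·A₀`.
[cite: Balaban1988RG2Cluster, (1.39) p.10] -/
def Oa {D : Type*} (κ₁ : ℝ) (_Y : D) (A : Fin 1 → ℝ) : ℂ := ((1 + κ₁ * A 0 : ℝ) : ℂ)

/-- MODEL (witness data). The clipping radius at coupling `s`, `ρ := s·√(r_P²n + 1)` (so that the box-SUPPORT law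
`χ_{Y₀}(B) ≠ 0 → |sB_b| ≤ ρ` holds for `χ_{Y₀} = 𝟙{⟨B,B⟩ < r_P²n + 1}`). [cite: Balaban1987RG1, (2.10)-(2.12) pp.267-268] -/
def rhoClip (s rP : ℝ) (n : ℕ) : ℝ := s * Real.sqrt (rP ^ 2 * n + 1)

/-- MODEL (witness data). The Lipschitz coefficient `κ₁ := 1∕(ρ + 1)` (so `c₀ + c₁ρ ≤ 2`). [cite: Balaban1988RG2Cluster, (1.39) p.10] -/
def kap1 (ρ : ℝ) : ℝ := 1 / (ρ + 1)

/-- `𝒲` and `𝒪` are measurable in the field. [cite: Balaban1988RG2Cluster, (1.34) p.9] -/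
theorem measurable_Wc_Oa {D : Type*} (κ₃ κ₁ : ℝ) (Y : D) : Measurable (Wc κ₃ Y) ∧ Measurable (Oa κ₁ Y) := by
  have h : Measurable fun A : Fin 1 → ℝ => A 0 := measurable_pi_apply 0
  unfold Wc Oa
  exact ⟨Complex.measurable_ofReal.comp ((h.pow_const 3).const_mul κ₃),
    Complex.measurable_ofReal.comp (measurable_const.add (h.const_mul κ₁))⟩

/-- On one bond the coordinate is dominated by the sup norm: `|A₀| ≤ ‖A‖`. [folklore] -/
private theorem abs_apply_le_norm (A : Fin 1 → ℝ) : |A 0| ≤ ‖A‖ := by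
  have h := norm_le_pi_norm A 0
  rwa [Real.norm_eq_abs] at h

/-- **(ℓ1) FOR THE MODEL's WILSON PART**: `|𝒲(Y,A)| = κ₃|A₀|·A₀² ≤ κ₃‖A‖·Σ_{b∈S(Y)}A_b²`, `S(Y) = univ`, `κ₃ ≥ 0` (on the
whole field space). [cite: Balaban1988RG2Cluster, (1.42) p.11; Balaban1987RG1, (2.8)-(2.10) pp.266-267] -/
theorem Wc_local {D : Type*} {κ₃ : ℝ} (hκ : 0 ≤ κ₃) (Y : D) (A : Fin 1 → ℝ) :
    ‖Wc κ₃ Y A‖ ≤ κ₃ * ‖A‖ * ∑ b ∈ (Finset.univ : Finset (Fin 1)), A b ^ 2 := by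
  unfold Wc
  rw [Complex.norm_real, Real.norm_eq_abs, abs_mul, abs_of_nonneg hκ, Fin.sum_univ_one, abs_pow,
    show |A 0| ^ 3 = |A 0| * A 0 ^ 2 by rw [pow_succ', sq_abs]]
  have h := abs_apply_le_norm A
  have h2 : 0 ≤ A 0 ^ 2 := sq_nonneg _
  calc κ₃ * (|A 0| * A 0 ^ 2) = κ₃ * |A 0| * A 0 ^ 2 := by ring
    _ ≤ κ₃ * ‖A‖ * A 0 ^ 2 := mul_le_mul_of_nonneg_right (mul_le_mul_of_nonneg_left h hκ) h2

/-- **(L0) AND (L4) FOR THE MODEL's OLDER PART**: `|𝒪(Y,0)| = 1` and `|𝒪(Y,A) − 𝒪(Y,0)| = κ₁|A₀| ≤ κ₁‖A‖` (`κ₁ ≥ 0`).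
[cite: Balaban1988RG2Cluster, (1.39) p.10] -/
theorem Oa_letters {D : Type*} {κ₁ : ℝ} (hκ : 0 ≤ κ₁) (Y : D) (A : Fin 1 → ℝ) :
    ‖Oa κ₁ Y 0‖ ≤ 1 ∧ ‖Oa κ₁ Y A - Oa κ₁ Y 0‖ ≤ κ₁ * ‖A‖ := by
  have h : Oa κ₁ Y A - Oa κ₁ Y 0 = ((κ₁ * A 0 : ℝ) : ℂ) := by unfold Oa; push_cast; simp
  refine ⟨by unfold Oa; simp, ?_⟩
  rw [h, Complex.norm_real, Real.norm_eq_abs, abs_mul, abs_of_nonneg hκ]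
  exact mul_le_mul_of_nonneg_left (abs_apply_le_norm A) hκ

/-- **THE BOX-SUPPORT LAW OF THE MODEL AT COUPLING `s ≥ 0`**: where `χ_{Y₀}(B) ≠ 0`, `|sB_b| ≤ ρ = s√(r_P²n + 1)`.
[cite: Balaban1987RG1, (2.10)-(2.12) pp.267-268] -/
theorem boxSupport_model {s : ℝ} (hs : 0 ≤ s) (rP : ℝ) (n : ℕ) (B : Fin 1 → ℝ) (h : chiS (rP ^ 2 * n + 1) B ≠ 0)
    (b : Fin 1) (_hb : b ∈ (Set.univ : Set (Fin 1))) : |(s • B) b| ≤ rhoClip s rP n := by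
  have hB : B ⬝ᵥ B < rP ^ 2 * n + 1 := by
    by_contra hc
    exact h (by unfold chiS; rw [if_neg hc])
  obtain rfl : b = 0 := Subsingleton.elim _ _
  have hB0 : B 0 ^ 2 < rP ^ 2 * n + 1 := by simpa [dotProduct, Fin.sum_univ_one, pow_two] using hB
  have h1 : |B 0| ≤ Real.sqrt (rP ^ 2 * n + 1) := by
    rw [← Real.sqrt_sq_eq_abs]
    exact Real.sqrt_le_sqrt hB0.le
  unfold rhoClip
  rw [Pi.smul_apply, smul_eq_mul, abs_mul, abs_of_nonneg hs]
  exact mul_le_mul_of_nonneg_left h1 hs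

/-- **LOCALITY OF THE MODEL POTENTIALS** in `S₀ = univ` (trivial). [cite: Balaban1988RG2Cluster, (1.20) p.6] -/
theorem local_model {D : Type*} (F : D → (Fin 1 → ℝ) → ℂ) (Y : D) (A A' : Fin 1 → ℝ)
    (h : ∀ b ∈ (Set.univ : Set (Fin 1)), A b = A' b) : F Y A = F Y A' := by
  rw [show A = A' from funext fun b => h b (Set.mem_univ b)]

variable {d L N' : ℕ} [NeZero L] [NeZero N'] {M : ℕ}

/-- MODEL (witness data). The cubic coefficient `κ₃ := 1∕(64(ρ + 1)(S + 1))` (so `2ρ·κ₃S ≤ 1∕32`). [cite: Balaban1988RG2Cluster, (2.20) p.16] -/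
def kap3 (c : B13.Consts) (t : Finset (TDom d (L * N')) × Finset (TBond d M (L * N'))) (ρ : ℝ) : ℝ :=
  1 / (64 * ((ρ + 1) * (SR c t + 1)))

/-- **THE PER-BOND MULTIPLICITY OF THE MODEL** (`S(Y) = univ`): `Σ_{Y∈𝐃, Y∋b} R_τ(Y)·κ₃ = κ₃·S`. [cite: Balaban1988RG2Cluster, (2.20) p.16] -/
theorem perBond_model (c : B13.Consts) (t : Finset (TDom d (L * N')) × Finset (TBond d M (L * N'))) (κ : ℝ)
    (bd : Fin 1) : ∑ Y ∈ t.1 with bd ∈ (Finset.univ : Finset (Fin 1)), Rτ c Y * κ ≤ κ * SR c t := by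
  rw [Finset.filter_true_of_mem fun _ _ => Finset.mem_univ bd, ← Finset.sum_mul]
  unfold SR
  exact le_of_eq (mul_comm _ _)

/-- **THE (2.20) RATE AND ADDITIVE LETTER OF THE LOCAL-GROWTH MODEL**: `κ₃, κ₁ > 0`, `(1 + ρ_b)²·(2ρ·κ₃S) ≤ 1∕16` and
`(1 + ρ_b)²·Σ_{Y∈𝐃}R_τ(Y)(1 + κ₁ρ) ≤ 4S`. [cite: Balaban1988RG2Cluster, (2.20) p.16, (2.24) p.17] -/
theorem rates_localGrowth_model (ν : ℕ) (c : B13.Consts) (t : Finset (TDom d (L * N')) × Finset (TBond d M (L * N')))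
    (hτ : ∀ x : ℝ, 0 ≤ x → 0 < invTau c x ∧ invTau c x ≤ 1 / 2) {ρ : ℝ} (hρ : 0 ≤ ρ) :
    0 < kap3 c t ρ ∧ 0 < kap1 ρ ∧
    (1 + rhoB ν) ^ 2 * (2 * ρ * (kap3 c t ρ * SR c t)) ≤ 1 / 16 ∧
    (1 + rhoB ν) ^ 2 * (∑ Y ∈ t.1, Rτ c Y * (1 + kap1 ρ * ρ)) ≤ 4 * SR c t := by
  have hS := SR_nonneg c t hτ
  obtain ⟨-, -, -, -, -, -, hsq2⟩ := transports_model ν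
  have hκ₃ : 0 < kap3 c t ρ := by unfold kap3; positivity
  have hκ₁ : 0 < kap1 ρ := by unfold kap1; positivity
  refine ⟨hκ₃, hκ₁, ?_, ?_⟩
  · have h1 : kap3 c t ρ * SR c t ≤ kap3 c t ρ * (SR c t + 1) := mul_le_mul_of_nonneg_left (by linarith) hκ₃.le
    have h2 : kap3 c t ρ * (SR c t + 1) = 1 / (64 * (ρ + 1)) := by
      unfold kap3; field_simp
    have h3 : 2 * ρ * (1 / (64 * (ρ + 1))) ≤ 1 / 32 := by
      rw [mul_one_div, div_le_div_iff₀ (by positivity) (by norm_num)]; nlinarith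
    have h4 : 2 * ρ * (kap3 c t ρ * SR c t) ≤ 1 / 32 := by
      calc 2 * ρ * (kap3 c t ρ * SR c t) ≤ 2 * ρ * (1 / (64 * (ρ + 1))) := by
            rw [← h2]; exact mul_le_mul_of_nonneg_left h1 (by positivity)
        _ ≤ 1 / 32 := h3
    have h5 : 0 ≤ 2 * ρ * (kap3 c t ρ * SR c t) := by positivity
    nlinarith
  · have h1 : (1 : ℝ) + kap1 ρ * ρ ≤ 2 := by
      unfold kap1; rw [div_mul_eq_mul_div, one_mul]
      have : ρ / (ρ + 1) ≤ 1 := (div_le_one (by positivity)).mpr (by linarith)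
      linarith
    have h2 : ∑ Y ∈ t.1, Rτ c Y * (1 + kap1 ρ * ρ) ≤ ∑ Y ∈ t.1, Rτ c Y * 2 :=
      Finset.sum_le_sum fun Y _ => mul_le_mul_of_nonneg_left h1 (Rτ_pos c hτ Y).le
    have h3 : ∑ Y ∈ t.1, Rτ c Y * 2 = 2 * SR c t := by rw [← Finset.sum_mul]; unfold SR; ring
    have hX0 : 0 ≤ ∑ Y ∈ t.1, Rτ c Y * (1 + kap1 ρ * ρ) :=
      Finset.sum_nonneg fun Y _ => mul_nonneg (Rτ_pos c hτ Y).le (by positivity)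
    rw [h3] at h2
    nlinarith [mul_le_mul hsq2 h2 hX0 (by norm_num : (0 : ℝ) ≤ 2)]

open Classical in
/-- **JOINT SATISFIABILITY OF THE LOCAL-GROWTH MEMBER ENGINE's BINDER LIST (A2 ∕ A6 WITNESS):**
`B13Term214WindowDilatedUnscaled.h226_torus_windowDilated_of_localGrowth_perBond` (the engine node N22's J10a keys on) APPLIED
at the model with EVERY binder discharged, for every torus ∕ site torus ∕ `Z` ∕ term label ∕ `r_P` ∕ COUPLING `s > 0` and every
`c` as in `h226_windowDilated_model` (kernels, regions, (2.22), rates, letters, `ρ_b`, primed letters, `θ`, numerics as there);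
the LOCAL-GROWTH block: cubic `𝒲(Y,A) = κ₃A₀³` ((ℓ1), `c₃ = κ₃`, `S(Y) = univ`), affine `𝒪(Y,A) = 1 + κ₁A₀` ((L0) `c₀ = 1`,
(L4) `c₁ = κ₁`), clipping radius `ρ = s√(r_P²|P| + 1)` with the box-SUPPORT law for `χ_{Y₀}` (`boxSupport_model`),
`S₀ = univ`, `R = R_τ`, `m₃ = κ₃S` (`perBond_model`), `a′ = 1∕16`, `w′ = 4S` (`rates_localGrowth_model`).  Same honest label
as §6 (σ-constant kernels; consistency is what is certified; `κ₃, κ₁ > 0`: the potentials are not field-constant).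
[cite: Balaban1988RG2Cluster, (2.14)–(2.15) p.15, (2.16)–(2.22) p.16, (2.23)–(2.26) p.17, (1.42) p.11; Balaban1987RG1, (2.9)-(2.13) pp.266-268] -/
theorem h226_localGrowth_model {ν : ℕ} (Nf : Fin ν → ℕ) [∀ i, NeZero (Nf i)] (c : B13.Consts) (hκ₁ : 1 ≤ c.κ₁)
    (hα₆ : c.α₆ ≠ 0) (hτ : ∀ x : ℝ, 0 ≤ x → 0 < invTau c x ∧ invTau c x ≤ 1 / 2)
    (Z : TDom d N') (t : Finset (TDom d (L * N')) × Finset (TBond d M (L * N'))) (rP : ℝ) {s : ℝ} (hs : 0 < s) :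
    ∀ b ∈ ball (1 : ℂ) (rhoB ν),
      ‖term214 (Real.exp c.κ₁ - 1) (Z.1 \ tclosure L N' (Z0 M t)).toList t.1.toList
          (core214 (fun _ => b ^ 2 • (1 : Matrix (Fin 1) (Fin 1) ℂ)) (fun _ X => b • Γm X)
            (F214 t.2.card (chiS (rP ^ 2 * t.2.card + 1)) (chiL (rP ^ 2 * t.2.card)) t.1
              (fun Y B => b ^ 2 * ((((s : ℝ) : ℂ) ^ 2)⁻¹ * Wc (kap3 c t (rhoClip s rP t.2.card)) Y (s • B))
                + Oa (kap1 (rhoClip s rP t.2.card)) Y (s • B)))) 0 0‖ ≤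
        weight L M c Z (1 / 16 * rP ^ 2) t * Real.exp ((1 + 4 * SR c t) * ((Z.1).card : ℝ)) := by
  obtain ⟨hpos, hhalf, hr, hUtau, hsubτ⟩ := regions_model c hκ₁ hτ (d := d) (L := L) (N' := N')
  have hS := SR_nonneg c t hτ
  have hρ : 0 ≤ rhoClip s rP t.2.card := by unfold rhoClip; positivity
  obtain ⟨hκ₃, hκ1, ha', hw'⟩ := rates_localGrowth_model ν c t hτ hρ
  obtain ⟨⟨hρ1, hKG', hKCs', hθΓ', hθC', hθE', -⟩, ⟨hθEle, hθΓle⟩, ⟨-, hsmallKθ⟩, h2θ⟩ :=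
    And.intro (transports_model ν) (And.intro (rhoB_le_thetaW ν) (And.intro (hsmallKθ_model ν) (two_theta_F_le ν)))
  obtain ⟨hG, hΓ₀, hCs, hC216, hCE, hdΓ, hdC, hdE⟩ := letters_model Nf (ι := TPt d N')
  have hZ1 : (1 : ℝ) ≤ ((Z.1).card : ℝ) := by exact_mod_cast Finset.card_pos.mpr Z.2.1
  have hvol := vol_model ν (by positivity : (0 : ℝ) ≤ 4 * SR c t) hZ1
  exact h226_torus_windowDilated_of_localGrowth_perBond c hκ₁ hα₆ Z t hpos hhalf (Uσ := Set.univ)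
    (Uτ := fun Y => ball (0 : ℂ) (Rτ c Y)) isOpen_univ (fun _ => isOpen_ball) (Set.subset_univ _) hUtau hr le_rfl hsubτ
    _ ⟨Finset.nodup_toList _, Finset.toList_toFinset _⟩ _ ⟨Finset.nodup_toList _, Finset.toList_toFinset _⟩
    (fun _ => (1 : Matrix (Fin 1) (Fin 1) ℂ)) (fun _ X => Γm X) (chiS (rP ^ 2 * t.2.card + 1)) (chiL (rP ^ 2 * t.2.card))
    (chiS_nonneg _) (chiL_nonneg _) t.1 (Wc (kap3 c t (rhoClip s rP t.2.card))) (Oa (kap1 (rhoClip s rP t.2.card)))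
    hs hρ Matrix.PosDef.one Gam0 (fun _ _ => differentiableOn_const _) (measurable_chiS _) (measurable_chiL _)
    (fun Y => (measurable_Wc_Oa (kap3 c t (rhoClip s rP t.2.card)) (kap1 (rhoClip s rP t.2.card)) Y).1)
    (fun Y => (measurable_Wc_Oa (kap3 c t (rhoClip s rP t.2.card)) (kap1 (rhoClip s rP t.2.card)) Y).2) (fun _ _ => Matrix.isSymm_one) (fun _ => Gm)
    (fun _ _ => differentiableOn_const _) (fun _ _ _ => rfl) (γ₂ := 1 / 16) (rP := rP) (fun B => B ⬝ᵥ B)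
    (fun B => h222_model _ (by norm_num) rP t.2.card B) (by norm_num) (fun _ => le_rfl)
    (R := Rτ c) (c₀ := fun _ => (1 : ℝ)) (c₁ := fun _ => kap1 (rhoClip s rP t.2.card))
    (c₃ := fun _ => kap3 c t (rhoClip s rP t.2.card)) (fun Y _ => (Rτ_pos c hτ Y).le) (fun _ _ => hκ₃.le)
    (fun _ _ => hκ1.le) (fun Y _ z hz => (mem_ball_zero_iff.mp hz).le) (fun Y _ => (Oa_letters hκ1.le Y 0).1)
    (fun _ => Finset.univ) (fun Y _ A _ => Wc_local hκ₃.le Y A) (fun Y _ A _ => (Oa_letters hκ1.le Y A).2)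
    (m₃ := kap3 c t (rhoClip s rP t.2.card) * SR c t) (by positivity) (perBond_model c t _)
    Set.univ (fun B hB b hb => boxSupport_model hs.le rP t.2.card B hB b hb)
    (fun Y _ A A' h => local_model _ Y A A' h) (fun Y _ A A' h => local_model _ Y A A' h)
    (fun _ => x0 Nf) (fun _ => x0 Nf) (m := 1) (fib_model_Λ Nf) (fib_model_N Nf)
    (kap := 3) (kap' := 2) (kap'' := 1) (θ := thetaW ν) (θE := 0) (θΓ := 0) (θC := 0) (KG := 1 / 2) (KΓ := 1 / 2)
    (KCs := 1) (K₀ := 1) (KE := 1) (by norm_num) (by norm_num) (by norm_num) le_rfl le_rfl le_rfl (by norm_num)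
    (by norm_num) zero_le_one zero_le_one zero_le_one hG hΓ₀ hCs hC216 hCE hdΓ hdC hdE
    (ρb := rhoB ν) (KG' := 1) (KCs' := 4) (θΓ' := rhoB ν / 2) (θC' := 10 * rhoB ν) (θE' := 3 * rhoB ν) (a' := 1 / 16)
    (w' := 4 * SR c t) hρ1 hKG' hKCs' hθΓ' hθC' hθE' ha' hw' hθEle hθΓle (hθR1le_model ν) hsmallKθ
    (cE := 1) (g := 1 / 4) zero_le_one (eigenvalues_one_le Matrix.PosDef.one) (by nlinarith [h2θ]) (by norm_num) Gam0_form
    (by nlinarith [h2θ]) (a := 1 / 16 * rP ^ 2) (a₅ := 1 + 4 * SR c t) le_rfl hvol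

open Classical in
/-- **THE SAME AT A LARGE-FIELD LABEL: the binder list of
`B13Term214WindowDilatedUnscaled.h226_torus_windowDilated_largeField_of_localGrowth_perBond` (`|P| ≥ 1`, (2.22) at `r_P`,
surplus radius `r₁`) is met at the local-growth model** — box-SUPPORT law (not the box law) and (2.22) jointly, at `P ≠ ∅`.
[cite: Balaban1988RG2Cluster, (2.14)–(2.15) p.15, (2.16)–(2.22) p.16, (2.23)–(2.26) p.17, (1.42) p.11; Balaban1987RG1, (2.9)-(2.13) pp.266-268] -/
theorem largeField_localGrowth_model {ν : ℕ} (Nf : Fin ν → ℕ) [∀ i, NeZero (Nf i)] (c : B13.Consts) (hκ₁ : 1 ≤ c.κ₁)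
    (hα₆ : c.α₆ ≠ 0) (hτ : ∀ x : ℝ, 0 ≤ x → 0 < invTau c x ∧ invTau c x ≤ 1 / 2)
    (Z : TDom d N') (t : Finset (TDom d (L * N')) × Finset (TBond d M (L * N'))) (hP1 : 1 ≤ t.2.card)
    {rP r₁ : ℝ} (hr₁ : r₁ ^ 2 ≤ rP ^ 2) {s : ℝ} (hs : 0 < s) :
    ∀ b ∈ ball (1 : ℂ) (rhoB ν),
      ‖term214 (Real.exp c.κ₁ - 1) (Z.1 \ tclosure L N' (Z0 M t)).toList t.1.toList
          (core214 (fun _ => b ^ 2 • (1 : Matrix (Fin 1) (Fin 1) ℂ)) (fun _ X => b • Γm X)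
            (F214 t.2.card (chiS (rP ^ 2 * t.2.card + 1)) (chiL (rP ^ 2 * t.2.card)) t.1
              (fun Y B => b ^ 2 * ((((s : ℝ) : ℂ) ^ 2)⁻¹ * Wc (kap3 c t (rhoClip s rP t.2.card)) Y (s • B))
                + Oa (kap1 (rhoClip s rP t.2.card)) Y (s • B)))) 0 0‖ ≤
        Real.exp (-(1 / 16 / 2 * (rP ^ 2 - r₁ ^ 2))) *
          (weight L M c Z (1 / 16 * r₁ ^ 2) t * Real.exp ((1 + 4 * SR c t) * ((Z.1).card : ℝ))) := by
  obtain ⟨hpos, hhalf, hr, hUtau, hsubτ⟩ := regions_model c hκ₁ hτ (d := d) (L := L) (N' := N')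
  have hS := SR_nonneg c t hτ
  have hρ : 0 ≤ rhoClip s rP t.2.card := by unfold rhoClip; positivity
  obtain ⟨hκ₃, hκ1, ha', hw'⟩ := rates_localGrowth_model ν c t hτ hρ
  obtain ⟨⟨hρ1, hKG', hKCs', hθΓ', hθC', hθE', -⟩, ⟨hθEle, hθΓle⟩, ⟨-, hsmallKθ⟩, h2θ⟩ :=
    And.intro (transports_model ν) (And.intro (rhoB_le_thetaW ν) (And.intro (hsmallKθ_model ν) (two_theta_F_le ν)))
  obtain ⟨hG, hΓ₀, hCs, hC216, hCE, hdΓ, hdC, hdE⟩ := letters_model Nf (ι := TPt d N')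
  have hZ1 : (1 : ℝ) ≤ ((Z.1).card : ℝ) := by exact_mod_cast Finset.card_pos.mpr Z.2.1
  have hvol := vol_model ν (by positivity : (0 : ℝ) ≤ 4 * SR c t) hZ1
  intro b hb
  exact h226_torus_windowDilated_largeField_of_localGrowth_perBond c hκ₁ hα₆ Z t hpos hhalf (Uσ := Set.univ)
    (Uτ := fun Y => ball (0 : ℂ) (Rτ c Y)) isOpen_univ (fun _ => isOpen_ball) (Set.subset_univ _) hUtau hr le_rfl hsubτ
    _ ⟨Finset.nodup_toList _, Finset.toList_toFinset _⟩ _ ⟨Finset.nodup_toList _, Finset.toList_toFinset _⟩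
    (fun _ => (1 : Matrix (Fin 1) (Fin 1) ℂ)) (fun _ X => Γm X) (chiS (rP ^ 2 * t.2.card + 1)) (chiL (rP ^ 2 * t.2.card))
    (chiS_nonneg _) (chiL_nonneg _) t.1 (Wc (kap3 c t (rhoClip s rP t.2.card))) (Oa (kap1 (rhoClip s rP t.2.card)))
    hs hρ Matrix.PosDef.one Gam0 (fun _ _ => differentiableOn_const _) (measurable_chiS _) (measurable_chiL _)
    (fun Y => (measurable_Wc_Oa (kap3 c t (rhoClip s rP t.2.card)) (kap1 (rhoClip s rP t.2.card)) Y).1)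
    (fun Y => (measurable_Wc_Oa (kap3 c t (rhoClip s rP t.2.card)) (kap1 (rhoClip s rP t.2.card)) Y).2) (fun _ _ => Matrix.isSymm_one) (fun _ => Gm)
    (fun _ _ => differentiableOn_const _) (fun _ _ _ => rfl) (γ₂ := 1 / 16) (fun B => B ⬝ᵥ B)
    (fun B => h222_model _ (by norm_num) rP t.2.card B) (by norm_num) (fun _ => le_rfl) hr₁ hP1
    (R := Rτ c) (c₀ := fun _ => (1 : ℝ)) (c₁ := fun _ => kap1 (rhoClip s rP t.2.card))
    (c₃ := fun _ => kap3 c t (rhoClip s rP t.2.card)) (fun Y _ => (Rτ_pos c hτ Y).le) (fun _ _ => hκ₃.le)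
    (fun _ _ => hκ1.le) (fun Y _ z hz => (mem_ball_zero_iff.mp hz).le) (fun Y _ => (Oa_letters hκ1.le Y 0).1)
    (fun _ => Finset.univ) (fun Y _ A _ => Wc_local hκ₃.le Y A) (fun Y _ A _ => (Oa_letters hκ1.le Y A).2)
    (m₃ := kap3 c t (rhoClip s rP t.2.card) * SR c t) (by positivity) (perBond_model c t _)
    Set.univ (fun B hB b hb => boxSupport_model hs.le rP t.2.card B hB b hb)
    (fun Y _ A A' h => local_model _ Y A A' h) (fun Y _ A A' h => local_model _ Y A A' h)
    (fun _ => x0 Nf) (fun _ => x0 Nf) (m := 1) (fib_model_Λ Nf) (fib_model_N Nf)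
    (kap := 3) (kap' := 2) (kap'' := 1) (θ := thetaW ν) (θE := 0) (θΓ := 0) (θC := 0) (KG := 1 / 2) (KΓ := 1 / 2)
    (KCs := 1) (K₀ := 1) (KE := 1) (by norm_num) (by norm_num) (by norm_num) le_rfl le_rfl le_rfl (by norm_num)
    (by norm_num) zero_le_one zero_le_one zero_le_one hG hΓ₀ hCs hC216 hCE hdΓ hdC hdE
    (ρb := rhoB ν) (KG' := 1) (KCs' := 4) (θΓ' := rhoB ν / 2) (θC' := 10 * rhoB ν) (θE' := 3 * rhoB ν) (a' := 1 / 16)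
    (w' := 4 * SR c t) hρ1 hKG' hKCs' hθΓ' hθC' hθE' ha' hw' hθEle hθΓle (hθR1le_model ν) hsmallKθ
    (cE := 1) (g := 1 / 4) zero_le_one (eigenvalues_one_le Matrix.PosDef.one) (by nlinarith [h2θ]) (by norm_num) Gam0_form
    (by nlinarith [h2θ]) (a := 1 / 16 * r₁ ^ 2) (a₅ := 1 + 4 * SR c t) le_rfl hvol b hb

end LocalGrowthModel

end Literature.MathematicalPhysics.QuantumFieldTheory.Balaban1983to89.B13Bound226Witness

end
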